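import Literature.Computability.Learning.AnalysisP
import Literature.Computability.Learning.LearnerParamsIneq
import Literature.Computability.Learning.NaturalLearning
import Literature.Computability.Learning.LearnerBudget
import Literature.Computability.Learning.NaturalLearningProofs
import Literature.Computability.MetaComplexity.SmolenskyConstructive
import HarnessLib

/-!
# CIKK 2016, Corollary 5.4: `AC⁰[p]` is learnable in quasi-polynomial time (discharge)

The discharge `cikk_learn_AC0Mod_holds` of the named fact
`Literature.Computability.Learning.cikk_learn_AC0Mod`, in four parts (each with its own header below):

1. **the parameter inequalities** (`lvlHyps_holds`, `half_pow_le_pZeroP`, `validFrac_ge_half`, `rep_boundP`, `val_boundP`);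
2. **an explicit good level** (`goodLvlP = 2^{mP}`, `goodLvlP_good`);
3. **quasi-polynomial budgets** (`coinLenP_le_pow`, `cikkCoinsP`, `cikkRoundsP`, `isQuasiPolyBudget_*`);
4. **the PAC guarantee and the discharge** (`isPACPredictorFor_cikkP`, `cikk_learn_AC0Mod_holds`).

## References

* M. Carmosino, R. Impagliazzo, V. Kabanets, A. Kolokolova, *Learning algorithms from natural
  proofs*, CCC 2016, Thm. 5.1, Cor. 5.4 [CarmosinoImpagliazzoKabanetsKolokolova2016].
* R. Smolensky, *Algebraic methods in the theory of lower bounds for Boolean circuit complexity*, STOC 1987 [Smolensky1987].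
-/

/-!
## Part — The `AC⁰[p]` learner: the parameter inequalities

Analysis for the named fact `Literature.Computability.Learning.cikk_learn_AC0Mod` (CIKK 2016,
Cor. 5.4): the analytic hypotheses `LevelP.LvlHyps n a b ℓ` of the one-run success bound hold at
every level for `a ≥ 1` (`lvlHyps_holds`), the one-run success probability is at least
`(1/2)^{E₀}` with `E₀` linear in the level parameters (`half_pow_le_pZeroP`), all `β`-blocks of a
run are valid with probability `≥ 1/2` (`validFrac_ge_half`), and the repetition and validation
budgets make the two failure terms `≤ 1/(4b)` each (`rep_boundP`, `val_boundP`).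

## References

* M. Carmosino, R. Impagliazzo, V. Kabanets, A. Kolokolova, *Learning algorithms from natural
  proofs*, CCC 2016, §5, Thm. 5.1 [CarmosinoImpagliazzoKabanetsKolokolova2016].
-/

namespace Literature.Computability.Learning

namespace Modp

open Literature.Computability.Complexity Literature.Computability.Complexity.DirectProduct Literature.Computability.Complexity.GaussRank
  Literature.Computability.MetaComplexity Literature.Computability.Cryptography _root_.Computability Finset

variable [P : PrimeP]

/-! ### Elementary facts about the parameters -/

section Basic

variable (n a b ℓ : ℕ)

/-- `2 ≤ P`. [folklore] -/
theorem two_le_PP : 2 ≤ PP := by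
  have h : 1 < Nat.size 𝔭 := Nat.lt_size.2 (by have := P.prime.two_le; simpa using this)
  unfold PP; omega

/-- `p < 2^P`. [folklore] -/
theorem p_lt_two_pow_PP : 𝔭 < 2 ^ PP := Nat.lt_size_self _

/-- `p ≤ 2^P` in `ℝ`. [folklore] -/
theorem p_le_two_pow_PP_real : (𝔭 : ℝ) ≤ (2 : ℝ) ^ PP := by exact_mod_cast (p_lt_two_pow_PP).le

/-- `2 ≤ p` in `ℝ`. [folklore] -/
theorem two_le_p_real : (2 : ℝ) ≤ 𝔭 := by exact_mod_cast P.prime.two_le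

omit P in
/-- `a < 2^s`. [folklore] -/
theorem a_lt_two_pow_sP : a < 2 ^ sP n a b := lt_of_le_of_lt (by omega) (Nat.lt_size_self (n + a + b + 2))

omit P in
/-- `b < 2^s`. [folklore] -/
theorem b_lt_two_pow_sP : b < 2 ^ sP n a b := lt_of_le_of_lt (by omega) (Nat.lt_size_self (n + a + b + 2))

omit P in
/-- `2 ≤ s`. [folklore] -/
theorem two_le_sP : 2 ≤ sP n a b := by
  have h : 1 < Nat.size (n + a + b + 2) := Nat.lt_size.2 (by omega)
  unfold sP; omega

/-- `T ≥ 64 (ℓ + 1)` (indeed `T = 2^{size ℓ + P + 4}`). [folklore] -/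
theorem TP_ge (ℓ : ℕ) : 64 * (ℓ + 1) ≤ TP ℓ := by
  have h1 := succ_le_two_pow_size ℓ
  have h2 : 2 ^ 6 ≤ 2 ^ (PP + 4) := Nat.pow_le_pow_right (by norm_num) (by have := two_le_PP; omega)
  rw [TP, τP, show Nat.size ℓ + PP + 4 = Nat.size ℓ + (PP + 4) by ring, pow_add]
  calc 64 * (ℓ + 1) = (ℓ + 1) * 2 ^ 6 := by ring
    _ ≤ 2 ^ Nat.size ℓ * 2 ^ (PP + 4) := Nat.mul_le_mul h1 h2

/-- `16 ≤ k`. [folklore] -/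
theorem kP_ge : 16 ≤ kP n a b ℓ := by
  rw [kP, κP, show (16 : ℕ) = 2 ^ 4 by norm_num]
  exact Nat.pow_le_pow_right (by norm_num) (by omega)

end Basic

/-! ### The real-valued bounds: `ν`, `1/(2p^T)`, `μ`, `θ`, `ρ` -/

section RealBounds

variable (n a b ℓ : ℕ)

/-- **`2ν ≤ 1/(40L)`**: `2^β ≥ 160 L T k p`. [folklore] -/
theorem two_nuP_le : 2 * nuP n a b ℓ ≤ 1 / (40 * (2 ^ ℓ : ℕ)) := by
  -- in `ℕ`: `2 · (2T) k p · 40 L ≤ 2^β`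
  have hp := (p_lt_two_pow_PP).le
  have e1 : 2 * (TP ℓ * 2) * kP n a b ℓ * 2 ^ PP * (64 * 2 ^ ℓ) = 2 ^ (τP ℓ + κP n a b ℓ + PP + ℓ + 8) := by
    rw [TP, kP, show (64 : ℕ) = 2 ^ 6 by norm_num, ← pow_succ, ← pow_succ', ← pow_add, ← pow_add, ← pow_add, ← pow_add]
    congr 1; omega
  have e2 : τP ℓ + κP n a b ℓ + PP + ℓ + 8 ≤ βP n a b ℓ := by unfold βP; omega
  have hN : 2 * (TP ℓ * 2) * kP n a b ℓ * 𝔭 * (40 * 2 ^ ℓ) ≤ 2 ^ βP n a b ℓ :=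
    calc 2 * (TP ℓ * 2) * kP n a b ℓ * 𝔭 * (40 * 2 ^ ℓ)
        ≤ 2 * (TP ℓ * 2) * kP n a b ℓ * 2 ^ PP * (64 * 2 ^ ℓ) :=
          Nat.mul_le_mul (Nat.mul_le_mul_left _ hp) (Nat.mul_le_mul_right _ (by norm_num))
      _ = 2 ^ (τP ℓ + κP n a b ℓ + PP + ℓ + 8) := e1
      _ ≤ 2 ^ βP n a b ℓ := Nat.pow_le_pow_right (by norm_num) e2
  have hN' : ((2 * (TP ℓ * 2) * kP n a b ℓ * 𝔭 * (40 * 2 ^ ℓ) : ℕ) : ℝ) ≤ ((2 ^ βP n a b ℓ : ℕ) : ℝ) := Nat.cast_le.2 hN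
  have hL : (0 : ℝ) < ((2 ^ ℓ : ℕ) : ℝ) := by positivity
  have hβ : (0 : ℝ) < (2 : ℝ) ^ βP n a b ℓ := pow_pos two_pos _
  rw [nuP, ← mul_div_assoc, div_le_div_iff₀ hβ (by positivity), one_mul, Nat.cast_pow]
  push_cast at hN' ⊢
  linarith

/-- **`1/(2p^T) ≤ 1/(40L)`**: `p^T ≥ 2^T ≥ 2^{ℓ+5}`. [folklore] -/
theorem inv_two_pT_le : 1 / (2 * (𝔭 : ℝ) ^ TP ℓ) ≤ 1 / (40 * (2 ^ ℓ : ℕ)) := by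
  have hp : (0 : ℝ) < 𝔭 := by exact_mod_cast P.prime.pos
  have hT : ℓ + 6 ≤ TP ℓ := by have := TP_ge ℓ; omega
  have h2T : (2 : ℝ) ^ (ℓ + 6) ≤ (𝔭 : ℝ) ^ TP ℓ :=
    (pow_le_pow_right₀ (by norm_num) hT).trans (pow_le_pow_left₀ (by norm_num) two_le_p_real _)
  rw [div_le_div_iff₀ (by positivity) (by positivity), one_mul, one_mul]
  push_cast
  have : (40 : ℝ) * 2 ^ ℓ ≤ 2 * 2 ^ (ℓ + 6) := by
    rw [pow_add]; nlinarith [pow_pos (two_pos : (0:ℝ) < 2) ℓ]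
  linarith

/-- **`μ ≥ 1/(20 L p 2T)`.** [folklore] -/
theorem muP_ge : 1 / (20 * (2 ^ ℓ : ℕ) * (𝔭 * (TP ℓ * 2 : ℕ))) ≤ muP n a b ℓ := by
  have h1 := two_nuP_le n a b ℓ
  have h2 := inv_two_pT_le ℓ
  have hp : (0 : ℝ) < 𝔭 := by exact_mod_cast P.prime.pos
  have hTr : (0 : ℝ) < TP ℓ := by exact_mod_cast TP_pos ℓ
  have hL : (0 : ℝ) < ((2 ^ ℓ : ℕ) : ℝ) := by positivity
  have hpT : (0 : ℝ) < 𝔭 * ((TP ℓ * 2 : ℕ) : ℝ) := by push_cast; positivity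
  rw [muP, le_div_iff₀ hpT]
  have hnum : 1 / (20 * (2 ^ ℓ : ℕ) : ℝ) ≤ 1 / (10 * (2 ^ ℓ : ℕ)) - 2 * nuP n a b ℓ - 1 / (2 * (𝔭 : ℝ) ^ TP ℓ) := by
    have e : (1 : ℝ) / (10 * (2 ^ ℓ : ℕ)) = 1 / (20 * (2 ^ ℓ : ℕ)) + 1 / (40 * (2 ^ ℓ : ℕ)) + 1 / (40 * (2 ^ ℓ : ℕ)) := by
      field_simp; ring
    linarith
  refine le_trans (le_of_eq ?_) hnum
  have hpT0 : (𝔭 : ℝ) * ((TP ℓ * 2 : ℕ) : ℝ) ≠ 0 := hpT.ne'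
  have hL0 : ((2 ^ ℓ : ℕ) : ℝ) ≠ 0 := hL.ne'
  field_simp

/-- `0 < μ`. [folklore] -/
theorem muP_pos : 0 < muP n a b ℓ := by
  refine lt_of_lt_of_le ?_ (muP_ge n a b ℓ)
  have := P.prime.pos; have := TP_pos ℓ; positivity

/-- **`θ = μ/(16p) ≥ 1/(640 L T p²)`.** [folklore] -/
theorem thetaP_ge : 1 / (640 * (2 ^ ℓ : ℕ) * TP ℓ * (𝔭 : ℝ) ^ 2) ≤ muP n a b ℓ / 2 / 2 / (4 * 𝔭) := by
  have h := muP_ge n a b ℓ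
  push_cast at h
  have hp : (0 : ℝ) < 𝔭 := by exact_mod_cast P.prime.pos
  have hT : (0 : ℝ) < TP ℓ := by exact_mod_cast TP_pos ℓ
  have hL : (0 : ℝ) < (2 : ℝ) ^ ℓ := by positivity
  rw [show muP n a b ℓ / 2 / 2 / (4 * 𝔭) = muP n a b ℓ / (16 * 𝔭) by field_simp; ring, le_div_iff₀ (by positivity)]
  refine le_trans (le_of_eq ?_) h
  push_cast
  field_simp
  ring

/-- **`ρ ≥ 1/(640 L T p^{kk+1})`.** [folklore] -/
theorem rhoP_ge : 1 / (640 * (2 ^ ℓ : ℕ) * TP ℓ * (𝔭 : ℝ) ^ (kkP n a b ℓ + 1)) ≤ rhoP n a b ℓ := by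
  have h := muP_ge n a b ℓ
  push_cast at h
  have hp : (0 : ℝ) < 𝔭 := by exact_mod_cast P.prime.pos
  have hT : (0 : ℝ) < TP ℓ := by exact_mod_cast TP_pos ℓ
  have hL : (0 : ℝ) < (2 : ℝ) ^ ℓ := by positivity
  rw [rhoP, show muP n a b ℓ / 2 / (8 * (𝔭 : ℝ) ^ kkP n a b ℓ) = muP n a b ℓ / (16 * (𝔭 : ℝ) ^ kkP n a b ℓ) by field_simp; ring,
    le_div_iff₀ (by positivity)]
  refine le_trans (le_of_eq ?_) h
  push_cast
  rw [pow_succ]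
  field_simp
  ring

/-- `0 < ρ`. [folklore] -/
theorem rhoP_pos : 0 < rhoP n a b ℓ := by
  have := muP_pos n a b ℓ; have := P.prime.pos; unfold rhoP; positivity

end RealBounds

/-! ### The GL condition, the threshold identity, nonemptiness of the sample space -/

section GLTheta

variable (n a b ℓ : ℕ)

/-- `0 < #reps`. [folklore] -/
theorem reps_card_pos : 0 < (reps 𝔭 (kkP n a b ℓ)).card := by
  haveI : Fact (Nat.Prime 𝔭) := P.fact
  have h := card_reps_ge (p := 𝔭) (kk := kkP n a b ℓ) (by unfold kkP; omega)
  exact lt_of_lt_of_le (Nat.pow_pos P.prime.pos) h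

/-- **The GL condition** `(k+1)p ≤ 2θ²·#reps`. [cite: CarmosinoImpagliazzoKabanetsKolokolova2016, Claim 4.4 (parameters)] -/
theorem hGL_holds : ((kP n a b ℓ + 1) * 𝔭 : ℝ) ≤ 2 * (muP n a b ℓ / 2 / 2 / (4 * 𝔭)) ^ 2 * (reps 𝔭 (kkP n a b ℓ)).card := by
  haveI : Fact (Nat.Prime 𝔭) := P.fact
  have hθ := thetaP_ge n a b ℓ
  have hp : (0 : ℝ) < 𝔭 := by exact_mod_cast P.prime.pos
  have hT : (0 : ℝ) < TP ℓ := by exact_mod_cast TP_pos ℓ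
  have hL : (0 : ℝ) < ((2 ^ ℓ : ℕ) : ℝ) := by positivity
  have hθ0 : (0 : ℝ) ≤ 1 / (640 * (2 ^ ℓ : ℕ) * TP ℓ * (𝔭 : ℝ) ^ 2) := by positivity
  -- `#reps ≥ p^{kk-1} ≥ 2^{kk-1}`
  have hreps : (2 : ℝ) ^ (kkP n a b ℓ - 1) ≤ (reps 𝔭 (kkP n a b ℓ)).card := by
    have h := card_reps_ge (p := 𝔭) (kk := kkP n a b ℓ) (by unfold kkP; omega)
    have h2 : 2 ^ (kkP n a b ℓ - 1) ≤ 𝔭 ^ (kkP n a b ℓ - 1) := Nat.pow_le_pow_left P.prime.two_le _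
    exact_mod_cast h2.trans h
  -- in `ℕ`: `(k+1) p (640 L T p²)² ≤ 2^{kk-1}`
  have hN : (kP n a b ℓ + 1) * 𝔭 * (640 * 2 ^ ℓ * TP ℓ * 𝔭 ^ 2) ^ 2 ≤ 2 ^ (kkP n a b ℓ - 1) := by
    have hk1 : kP n a b ℓ + 1 ≤ 2 ^ (κP n a b ℓ + 1) := by rw [kP, pow_succ]; have := Nat.one_le_two_pow (n := κP n a b ℓ); omega
    have hp5 : 𝔭 * (𝔭 ^ 2) ^ 2 ≤ 2 ^ (5 * PP) := by
      rw [show 𝔭 * (𝔭 ^ 2) ^ 2 = 𝔭 ^ 5 by ring, show 5 * PP = PP * 5 by ring, pow_mul]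
      exact Nat.pow_le_pow_left (p_lt_two_pow_PP).le _
    have h640 : (640 : ℕ) ^ 2 ≤ 2 ^ 19 := by norm_num
    calc (kP n a b ℓ + 1) * 𝔭 * (640 * 2 ^ ℓ * TP ℓ * 𝔭 ^ 2) ^ 2
        = (kP n a b ℓ + 1) * (𝔭 * (𝔭 ^ 2) ^ 2) * 640 ^ 2 * ((2 ^ ℓ) ^ 2 * TP ℓ ^ 2) := by ring
      _ ≤ 2 ^ (κP n a b ℓ + 1) * 2 ^ (5 * PP) * 2 ^ 19 * ((2 ^ ℓ) ^ 2 * TP ℓ ^ 2) :=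
          Nat.mul_le_mul_right _ (Nat.mul_le_mul (Nat.mul_le_mul hk1 hp5) h640)
      _ = 2 ^ (κP n a b ℓ + 1 + 5 * PP + 19 + 2 * ℓ + 2 * τP ℓ) := by rw [TP, ← pow_mul, ← pow_mul]; ring
      _ ≤ 2 ^ (kkP n a b ℓ - 1) := Nat.pow_le_pow_right (by norm_num) (by unfold kkP; omega)
  have hN' : ((kP n a b ℓ + 1) * 𝔭 : ℝ) * (640 * (2 ^ ℓ : ℕ) * TP ℓ * (𝔭 : ℝ) ^ 2) ^ 2 ≤ (2 : ℝ) ^ (kkP n a b ℓ - 1) := by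
    exact_mod_cast hN
  -- assemble
  have hsq : (1 / (640 * (2 ^ ℓ : ℕ) * TP ℓ * (𝔭 : ℝ) ^ 2)) ^ 2 ≤ (muP n a b ℓ / 2 / 2 / (4 * 𝔭)) ^ 2 := pow_le_pow_left₀ hθ0 hθ 2
  set D : ℝ := 640 * (2 ^ ℓ : ℕ) * TP ℓ * (𝔭 : ℝ) ^ 2 with hDdef
  have hD : (0 : ℝ) < D := by rw [hDdef]; exact mul_pos (mul_pos (mul_pos (by norm_num) hL) hT) (pow_pos hp 2)
  have hid : ((kP n a b ℓ + 1) * 𝔭 : ℝ) = ((kP n a b ℓ + 1) * 𝔭 : ℝ) * D ^ 2 * (1 / D) ^ 2 := by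
    rw [one_div, inv_pow, mul_assoc, mul_inv_cancel₀ (pow_ne_zero 2 hD.ne'), mul_one]
  have hsq0 : (0 : ℝ) ≤ (1 / D) ^ 2 := sq_nonneg _
  have hθsq0 : (0 : ℝ) ≤ (muP n a b ℓ / 2 / 2 / (4 * 𝔭)) ^ 2 := sq_nonneg _
  have hR0 : (0 : ℝ) ≤ (reps 𝔭 (kkP n a b ℓ)).card := Nat.cast_nonneg _
  have h1 : ((kP n a b ℓ + 1) * 𝔭 : ℝ) * D ^ 2 * (1 / D) ^ 2 ≤ (2 : ℝ) ^ (kkP n a b ℓ - 1) * (1 / D) ^ 2 := mul_le_mul_of_nonneg_right hN' hsq0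
  have h2 : (2 : ℝ) ^ (kkP n a b ℓ - 1) * (1 / D) ^ 2 ≤ (reps 𝔭 (kkP n a b ℓ)).card * (muP n a b ℓ / 2 / 2 / (4 * 𝔭)) ^ 2 :=
    mul_le_mul hreps hsq (sq_nonneg _) hR0
  have h3 : 0 ≤ (muP n a b ℓ / 2 / 2 / (4 * 𝔭)) ^ 2 * (reps 𝔭 (kkP n a b ℓ)).card := mul_nonneg hθsq0 hR0
  rw [hid]
  linarith

end GLTheta

/-! ### The threshold fraction is `μ/(16p)` -/

section Theta

variable (n a b ℓ : ℕ)

/-- The two subtracted terms of `θN` are dominated: `B₁ + B₂ ≤ A`. [folklore] -/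
theorem thetaN_parts_le :
    2 * (TP ℓ * 2 * kP n a b ℓ * 𝔭) * (10 * 2 ^ ℓ) * (2 * 𝔭 ^ TP ℓ) + 10 * 2 ^ ℓ * 2 ^ βP n a b ℓ ≤ 2 ^ βP n a b ℓ * (2 * 𝔭 ^ TP ℓ) := by
  -- `B₁ ≤ A/4`: `8 · 2Tkp · 10L ≤ 2^β`
  have hp := (p_lt_two_pow_PP).le
  have e1 : 2 * (TP ℓ * 2) * kP n a b ℓ * 2 ^ PP * (64 * 2 ^ ℓ) = 2 ^ (τP ℓ + κP n a b ℓ + PP + ℓ + 8) := by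
    rw [TP, kP, show (64 : ℕ) = 2 ^ 6 by norm_num, ← pow_succ, ← pow_succ', ← pow_add, ← pow_add, ← pow_add, ← pow_add]
    congr 1; omega
  have hB1 : 4 * (2 * (TP ℓ * 2 * kP n a b ℓ * 𝔭) * (10 * 2 ^ ℓ)) ≤ 2 ^ βP n a b ℓ := by
    calc 4 * (2 * (TP ℓ * 2 * kP n a b ℓ * 𝔭) * (10 * 2 ^ ℓ)) = 2 * (TP ℓ * 2) * kP n a b ℓ * 𝔭 * (40 * 2 ^ ℓ) := by ring
      _ ≤ 2 * (TP ℓ * 2) * kP n a b ℓ * 2 ^ PP * (64 * 2 ^ ℓ) := Nat.mul_le_mul (Nat.mul_le_mul_left _ hp) (Nat.mul_le_mul_right _ (by norm_num))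
      _ = 2 ^ (τP ℓ + κP n a b ℓ + PP + ℓ + 8) := e1
      _ ≤ 2 ^ βP n a b ℓ := Nat.pow_le_pow_right (by norm_num) (by unfold βP; omega)
  -- `B₂ ≤ A/4`: `40 L ≤ 2 p^T`
  have hB2 : 4 * (10 * 2 ^ ℓ) ≤ 2 * 𝔭 ^ TP ℓ := by
    have hT : ℓ + 6 ≤ TP ℓ := by have := TP_ge ℓ; omega
    calc 4 * (10 * 2 ^ ℓ) ≤ 64 * 2 ^ ℓ := by omega
      _ = 2 ^ (ℓ + 6) := by rw [pow_add]; ring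
      _ ≤ 2 ^ TP ℓ := Nat.pow_le_pow_right (by norm_num) hT
      _ ≤ 𝔭 ^ TP ℓ := Nat.pow_le_pow_left P.prime.two_le _
      _ ≤ 2 * 𝔭 ^ TP ℓ := Nat.le_mul_of_pos_left _ (by norm_num)
  have hA := Nat.mul_le_mul hB1 hB2
  have hpT : 1 ≤ 𝔭 ^ TP ℓ := Nat.one_le_pow _ _ P.prime.pos
  have h2β : 1 ≤ 2 ^ βP n a b ℓ := Nat.one_le_two_pow
  nlinarith

/-- **`θN/θD = μ/2/2/(4p)`** (the learner's threshold fraction is the analysis' `θ`). [folklore] -/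
theorem theta_eq : (θNP n a b ℓ : ℝ) / θDP n a b ℓ = muP n a b ℓ / 2 / 2 / (4 * 𝔭) := by
  have hp : (0 : ℝ) < 𝔭 := by exact_mod_cast P.prime.pos
  have hT : (0 : ℝ) < TP ℓ := by exact_mod_cast TP_pos ℓ
  have hL : (0 : ℝ) < (2 : ℝ) ^ ℓ := pow_pos two_pos _
  have hβ : (0 : ℝ) < (2 : ℝ) ^ βP n a b ℓ := pow_pos two_pos _
  have hpT : (0 : ℝ) < (𝔭 : ℝ) ^ TP ℓ := pow_pos hp _
  have hparts := thetaN_parts_le n a b ℓ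
  -- cast the truncated subtraction
  have hB1le : 2 * (TP ℓ * 2 * kP n a b ℓ * 𝔭) * (10 * 2 ^ ℓ) * (2 * 𝔭 ^ TP ℓ) ≤ 2 ^ βP n a b ℓ * (2 * 𝔭 ^ TP ℓ) := le_trans (Nat.le_add_right _ _) hparts
  have hB2le : 10 * 2 ^ ℓ * 2 ^ βP n a b ℓ ≤ 2 ^ βP n a b ℓ * (2 * 𝔭 ^ TP ℓ) - 2 * (TP ℓ * 2 * kP n a b ℓ * 𝔭) * (10 * 2 ^ ℓ) * (2 * 𝔭 ^ TP ℓ) := by omega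
  have hcast : (θNP n a b ℓ : ℝ) = (2 : ℝ) ^ βP n a b ℓ * (2 * (𝔭 : ℝ) ^ TP ℓ) -
      2 * ((TP ℓ : ℝ) * 2 * kP n a b ℓ * 𝔭) * (10 * (2 : ℝ) ^ ℓ) * (2 * (𝔭 : ℝ) ^ TP ℓ) - 10 * (2 : ℝ) ^ ℓ * (2 : ℝ) ^ βP n a b ℓ := by
    rw [θNP, Nat.cast_sub hB2le, Nat.cast_sub hB1le]
    push_cast
    ring
  set D₀ : ℝ := 10 * (2 : ℝ) ^ ℓ * (2 : ℝ) ^ βP n a b ℓ * (2 * (𝔭 : ℝ) ^ TP ℓ) with hD₀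
  have hD₀pos : 0 < D₀ := by rw [hD₀]; exact mul_pos (mul_pos (mul_pos (by norm_num) hL) hβ) (mul_pos two_pos hpT)
  set Num : ℝ := 1 / (10 * (2 ^ ℓ : ℕ)) - 2 * nuP n a b ℓ - 1 / (2 * (𝔭 : ℝ) ^ TP ℓ) with hNum
  have h10L : (10 : ℝ) * (2 : ℝ) ^ ℓ ≠ 0 := by positivity
  have h2pT : (2 : ℝ) * (𝔭 : ℝ) ^ TP ℓ ≠ 0 := (mul_pos two_pos hpT).ne'
  have e1 : 1 / (10 * (2 : ℝ) ^ ℓ) * D₀ = (2 : ℝ) ^ βP n a b ℓ * (2 * (𝔭 : ℝ) ^ TP ℓ) := by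
    rw [hD₀, show (10 : ℝ) * (2 : ℝ) ^ ℓ * (2 : ℝ) ^ βP n a b ℓ * (2 * (𝔭 : ℝ) ^ TP ℓ) =
      (10 * (2 : ℝ) ^ ℓ) * ((2 : ℝ) ^ βP n a b ℓ * (2 * (𝔭 : ℝ) ^ TP ℓ)) by ring, one_div, ← mul_assoc, inv_mul_cancel₀ h10L, one_mul]
  have e2 : 2 * nuP n a b ℓ * D₀ = 2 * ((TP ℓ : ℝ) * 2 * kP n a b ℓ * 𝔭) * (10 * (2 : ℝ) ^ ℓ) * (2 * (𝔭 : ℝ) ^ TP ℓ) := by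
    have hc : ((TP ℓ * 2 : ℕ) : ℝ) * (kP n a b ℓ) * 𝔭 / (2 : ℝ) ^ βP n a b ℓ * (2 : ℝ) ^ βP n a b ℓ = ((TP ℓ * 2 : ℕ) : ℝ) * (kP n a b ℓ) * 𝔭 :=
      div_mul_cancel₀ _ hβ.ne'
    rw [nuP, hD₀]
    calc 2 * (((TP ℓ * 2 : ℕ) : ℝ) * (kP n a b ℓ) * 𝔭 / (2 : ℝ) ^ βP n a b ℓ) * (10 * (2 : ℝ) ^ ℓ * (2 : ℝ) ^ βP n a b ℓ * (2 * (𝔭 : ℝ) ^ TP ℓ))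
        = 2 * (((TP ℓ * 2 : ℕ) : ℝ) * (kP n a b ℓ) * 𝔭 / (2 : ℝ) ^ βP n a b ℓ * (2 : ℝ) ^ βP n a b ℓ) * (10 * (2 : ℝ) ^ ℓ) * (2 * (𝔭 : ℝ) ^ TP ℓ) := by ring
      _ = 2 * ((TP ℓ : ℝ) * 2 * kP n a b ℓ * 𝔭) * (10 * (2 : ℝ) ^ ℓ) * (2 * (𝔭 : ℝ) ^ TP ℓ) := by rw [hc]; push_cast; ring
  have e3 : 1 / (2 * (𝔭 : ℝ) ^ TP ℓ) * D₀ = 10 * (2 : ℝ) ^ ℓ * (2 : ℝ) ^ βP n a b ℓ := by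
    rw [hD₀, show (10 : ℝ) * (2 : ℝ) ^ ℓ * (2 : ℝ) ^ βP n a b ℓ * (2 * (𝔭 : ℝ) ^ TP ℓ) =
      (2 * (𝔭 : ℝ) ^ TP ℓ) * (10 * (2 : ℝ) ^ ℓ * (2 : ℝ) ^ βP n a b ℓ) by ring, one_div, ← mul_assoc, inv_mul_cancel₀ h2pT, one_mul]
  have hN : (θNP n a b ℓ : ℝ) = Num * D₀ := by
    rw [hcast, hNum]
    push_cast
    rw [sub_mul, sub_mul, e1, e2, e3]
  have hDD : (θDP n a b ℓ : ℝ) = D₀ * ((𝔭 : ℝ) * ((TP ℓ : ℝ) * 2) * (16 * 𝔭)) := by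
    rw [θDP, hD₀]; push_cast; ring
  have hX : (0 : ℝ) < (𝔭 : ℝ) * ((TP ℓ : ℝ) * 2) * (16 * 𝔭) := mul_pos (mul_pos hp (mul_pos hT two_pos)) (mul_pos (by norm_num) hp)
  calc (θNP n a b ℓ : ℝ) / θDP n a b ℓ = (D₀ * Num) / (D₀ * ((𝔭 : ℝ) * ((TP ℓ : ℝ) * 2) * (16 * 𝔭))) := by rw [hN, hDD, mul_comm]
    _ = Num / ((𝔭 : ℝ) * ((TP ℓ : ℝ) * 2) * (16 * 𝔭)) := mul_div_mul_left _ _ hD₀pos.ne'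
    _ = muP n a b ℓ / 2 / 2 / (4 * 𝔭) := by
        rw [muP, ← hNum, div_div, div_div, div_div]
        push_cast
        congr 1
        ring

end Theta

/-! ### The three exponential conditions -/

section Exp

variable (n a b ℓ : ℕ)

/-- The exponent `E_H = 2ℓ + 2τ + (2kk+2)P + s + 35` (`ρ²/(4a·4096) ≥ 2^{-E_H}`). [folklore] -/
def EHP : ℕ := 2 * ℓ + 2 * τP ℓ + 2 * ((kkP n a b ℓ + 1) * PP) + sP n a b + 35

/-- **`E_H ≤ 2^{s + size ℓ + 2P + 6} · 1`** (a polynomial in the logarithmic parameters). [folklore] -/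
theorem EHP_le : EHP n a b ℓ ≤ 2 ^ (sP n a b + Nat.size ℓ + 2 * PP + 6) := by
  have hΛ : ℓ < 2 ^ Nat.size ℓ := Nat.lt_size_self ℓ
  have hΛ2 : Nat.size ℓ < 2 ^ Nat.size ℓ := Nat.lt_two_pow_self
  have hs : sP n a b < 2 ^ sP n a b := Nat.lt_two_pow_self
  have hPQ : PP < 2 ^ PP := Nat.lt_two_pow_self
  have hP2 := two_le_PP
  have hs2 := two_le_sP n a b
  set Λ := 2 ^ Nat.size ℓ with hΛdef
  set S := 2 ^ sP n a b with hS
  set Q := 2 ^ PP with hQ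
  have hS4 : 4 ≤ S := by rw [hS]; calc (4 : ℕ) = 2 ^ 2 := rfl
    _ ≤ 2 ^ sP n a b := Nat.pow_le_pow_right (by norm_num) hs2
  have hQ4 : 4 ≤ Q := by rw [hQ]; calc (4 : ℕ) = 2 ^ 2 := rfl
    _ ≤ 2 ^ PP := Nat.pow_le_pow_right (by norm_num) hP2
  have hΛ1 : 1 ≤ Λ := Nat.one_le_two_pow
  -- `E_H ≤ (7s + 14Λ + 24P + 201) P`
  have h1 : EHP n a b ℓ ≤ (7 * sP n a b + 14 * Λ + 24 * PP + 201) * PP := by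
    have e : EHP n a b ℓ = 2 * ℓ + 2 * (Nat.size ℓ + PP + 4) + 2 * ((3 * sP n a b + Nat.size ℓ + 4 * PP + 40 + 2 * ℓ +
        2 * (Nat.size ℓ + PP + 4) + 5 * PP + 30 + 1) * PP) + sP n a b + 35 := by rfl
    rw [e]
    have hP1 : 1 ≤ PP := by omega
    nlinarith [hΛ.le, hΛ2.le]
  -- `7s + 14Λ + 24P + 201 ≤ 64 S Λ Q`
  have hQ1 : 1 ≤ Q := by omega
  have hS1 : 1 ≤ S := by omega
  have hSΛQ : 16 ≤ S * Λ * Q := by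
    calc (16 : ℕ) = 4 * 1 * 4 := rfl
      _ ≤ S * Λ * Q := Nat.mul_le_mul (Nat.mul_le_mul hS4 hΛ1) hQ4
  have tS : S ≤ S * Λ * Q := by
    calc S = S * 1 * 1 := by ring
      _ ≤ S * Λ * Q := Nat.mul_le_mul (Nat.mul_le_mul_left _ hΛ1) hQ1
  have tΛ : Λ ≤ S * Λ * Q := by
    calc Λ = 1 * Λ * 1 := by ring
      _ ≤ S * Λ * Q := Nat.mul_le_mul (Nat.mul_le_mul_right _ hS1) hQ1
  have tQ : Q ≤ S * Λ * Q := by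
    calc Q = 1 * 1 * Q := by ring
      _ ≤ S * Λ * Q := Nat.mul_le_mul_right _ (Nat.mul_le_mul hS1 hΛ1)
  have h2 : 7 * sP n a b + 14 * Λ + 24 * PP + 201 ≤ 64 * (S * Λ * Q) := by
    have t1 : sP n a b ≤ S * Λ * Q := hs.le.trans tS
    have t3 : PP ≤ S * Λ * Q := hPQ.le.trans tQ
    omega
  calc EHP n a b ℓ ≤ (7 * sP n a b + 14 * Λ + 24 * PP + 201) * PP := h1
    _ ≤ 64 * (S * Λ * Q) * Q := Nat.mul_le_mul h2 hPQ.le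
    _ = 2 ^ (sP n a b + Nat.size ℓ + 2 * PP + 6) := by
        rw [hS, hΛdef, hQ, show (64 : ℕ) = 2 ^ 6 by norm_num, ← pow_add, ← pow_add, ← pow_add, ← pow_add]; congr 1; ring

/-- The common denominator `D = 640 L T p^{kk+1}` of the `ρ` bound is positive. [folklore] -/
theorem rhoDen_pos : (0 : ℝ) < 640 * (2 : ℝ) ^ ℓ * TP ℓ * (𝔭 : ℝ) ^ (kkP n a b ℓ + 1) := by
  have hp : (0 : ℝ) < 𝔭 := by exact_mod_cast P.prime.pos
  have hT : (0 : ℝ) < TP ℓ := by exact_mod_cast TP_pos ℓ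
  exact mul_pos (mul_pos (mul_pos (by norm_num) (pow_pos two_pos _)) hT) (pow_pos hp _)

/-- `ρ ≥ 1/D` with real powers of two. [folklore] -/
theorem rhoP_ge' : 1 / (640 * (2 : ℝ) ^ ℓ * TP ℓ * (𝔭 : ℝ) ^ (kkP n a b ℓ + 1)) ≤ rhoP n a b ℓ := by
  have h := rhoP_ge n a b ℓ; push_cast at h; exact h

/-- **`1 ≤ 2^{E_H} · ρ² (1/(4a)) / 4096`** (`0 < a`). [folklore] -/
theorem one_le_two_pow_EHP_mul (ha4 : (0 : ℝ) < 4 * a) : 1 ≤ (2 : ℝ) ^ EHP n a b ℓ * (rhoP n a b ℓ ^ 2 * (1 / (4 * (a : ℝ))) / 4096) := by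
  obtain ⟨D, hD⟩ : ∃ D : ℝ, D = 640 * (2 : ℝ) ^ ℓ * TP ℓ * (𝔭 : ℝ) ^ (kkP n a b ℓ + 1) := ⟨_, rfl⟩
  have hDpos : 0 < D := by rw [hD]; exact rhoDen_pos n a b ℓ
  have hρ : 1 / D ≤ rhoP n a b ℓ := by rw [hD]; exact rhoP_ge' n a b ℓ
  have hρ0 : 0 ≤ 1 / D := (one_div_pos.2 hDpos).le
  have hρsq : (1 / D) ^ 2 ≤ rhoP n a b ℓ ^ 2 := pow_le_pow_left₀ hρ0 hρ 2
  have hδ0 : (0 : ℝ) ≤ 1 / (4 * a) := (one_div_pos.2 ha4).le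
  -- in `ℕ`: `D² · (4·2^s) · 4096 ≤ 2^{E_H}`
  have hN : (640 * 2 ^ ℓ * TP ℓ * 𝔭 ^ (kkP n a b ℓ + 1)) ^ 2 * (4 * 2 ^ sP n a b) * 4096 ≤ 2 ^ EHP n a b ℓ := by
    have hp2 : 𝔭 ^ (kkP n a b ℓ + 1) ≤ 2 ^ (PP * (kkP n a b ℓ + 1)) := by
      rw [pow_mul]; exact Nat.pow_le_pow_left (p_lt_two_pow_PP).le _
    have h1 : 640 * 2 ^ ℓ * TP ℓ * 𝔭 ^ (kkP n a b ℓ + 1) ≤ 1024 * 2 ^ ℓ * TP ℓ * 2 ^ (PP * (kkP n a b ℓ + 1)) :=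
      Nat.mul_le_mul (Nat.mul_le_mul_right _ (Nat.mul_le_mul_right _ (by norm_num))) hp2
    calc (640 * 2 ^ ℓ * TP ℓ * 𝔭 ^ (kkP n a b ℓ + 1)) ^ 2 * (4 * 2 ^ sP n a b) * 4096
        ≤ (1024 * 2 ^ ℓ * TP ℓ * 2 ^ (PP * (kkP n a b ℓ + 1))) ^ 2 * (4 * 2 ^ sP n a b) * 4096 :=
          Nat.mul_le_mul_right _ (Nat.mul_le_mul_right _ (Nat.pow_le_pow_left h1 2))
      _ = 2 ^ (2 * (10 + ℓ + τP ℓ + PP * (kkP n a b ℓ + 1)) + 2 + sP n a b + 12) := by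
          rw [TP, show (1024 : ℕ) = 2 ^ 10 by norm_num, show (4096 : ℕ) = 2 ^ 12 by norm_num, show (4 : ℕ) = 2 ^ 2 by norm_num]
          rw [← pow_add, ← pow_add, ← pow_add, ← pow_mul, ← pow_add, ← pow_add, ← pow_add]; congr 1; ring
      _ ≤ 2 ^ EHP n a b ℓ := Nat.pow_le_pow_right (by norm_num) (by unfold EHP; nlinarith)
  have hN' : (D ^ 2 * (4 * (2 : ℝ) ^ sP n a b) * 4096 : ℝ) ≤ (2 : ℝ) ^ EHP n a b ℓ := by rw [hD]; exact_mod_cast hN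
  have ha1 : (4 * (a : ℝ)) ≤ 4 * (2 : ℝ) ^ sP n a b := by
    have := (a_lt_two_pow_sP n a b).le; exact_mod_cast Nat.mul_le_mul_left 4 this
  have hS : (0 : ℝ) < 4 * (2 : ℝ) ^ sP n a b := by positivity
  have hden : (0 : ℝ) < D ^ 2 * (4 * (2 : ℝ) ^ sP n a b) * 4096 := mul_pos (mul_pos (pow_pos hDpos 2) hS) (by norm_num)
  have hden' : (0 : ℝ) < D ^ 2 * (4 * (a : ℝ)) * 4096 := mul_pos (mul_pos (pow_pos hDpos 2) ha4) (by norm_num)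
  calc (1 : ℝ) ≤ (2 : ℝ) ^ EHP n a b ℓ / (D ^ 2 * (4 * (2 : ℝ) ^ sP n a b) * 4096) := (one_le_div hden).2 hN'
    _ ≤ (2 : ℝ) ^ EHP n a b ℓ / (D ^ 2 * (4 * (a : ℝ)) * 4096) := by
        refine div_le_div_of_nonneg_left (pow_nonneg two_pos.le _) hden' ?_
        exact mul_le_mul_of_nonneg_right (mul_le_mul_of_nonneg_left ha1 (sq_nonneg _)) (by norm_num)
    _ = (2 : ℝ) ^ EHP n a b ℓ * ((1 / D) ^ 2 * (1 / (4 * (a : ℝ))) / 4096) := by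
        rw [one_div, one_div, inv_pow, div_eq_mul_inv, mul_inv, mul_inv]; ring
    _ ≤ (2 : ℝ) ^ EHP n a b ℓ * (rhoP n a b ℓ ^ 2 * (1 / (4 * (a : ℝ))) / 4096) := by
        refine mul_le_mul_of_nonneg_left ?_ (pow_nonneg two_pos.le _)
        exact div_le_div_of_nonneg_right (mul_le_mul_of_nonneg_right hρsq hδ0) (by norm_num)

/-- `2^{15} · 2^{2s} · E_H ≤ k`. [folklore] -/
theorem EHP_mul_le_kP : 2 ^ 15 * 2 ^ (2 * sP n a b) * EHP n a b ℓ ≤ kP n a b ℓ := by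
  have h := EHP_le n a b ℓ
  calc 2 ^ 15 * 2 ^ (2 * sP n a b) * EHP n a b ℓ ≤ 2 ^ 15 * 2 ^ (2 * sP n a b) * 2 ^ (sP n a b + Nat.size ℓ + 2 * PP + 6) :=
        Nat.mul_le_mul_left _ h
    _ = 2 ^ (15 + 2 * sP n a b + (sP n a b + Nat.size ℓ + 2 * PP + 6)) := by rw [← pow_add, ← pow_add]
    _ ≤ kP n a b ℓ := by rw [kP]; exact Nat.pow_le_pow_right (by norm_num) (by unfold κP; omega)

omit P in
/-- `0 < 4a` for `a ≥ 1`. [folklore] -/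
theorem four_a_pos (ha : 1 ≤ a) : (0 : ℝ) < 4 * a := by
  have : (1 : ℝ) ≤ a := by exact_mod_cast ha
  linarith

/-- **(H1u)** `exp(-(3δ₁k/2048)) ≤ ρ² δ₁ / 4096` with `δ₁ = 1/(4a)`. [folklore] -/
theorem H1u_holds (ha : 1 ≤ a) : Real.exp (-(3 * (1 / (4 * (a : ℝ))) * kP n a b ℓ / 2048)) ≤ rhoP n a b ℓ ^ 2 * (1 / (4 * (a : ℝ))) / 4096 := by
  have ha0 := four_a_pos a ha
  refine exp_neg_le_of (EHP n a b ℓ) ?_ (one_le_two_pow_EHP_mul n a b ℓ ha0)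
  have h := EHP_mul_le_kP n a b ℓ
  -- `8192 a E_H ≤ k`
  have ha' : a ≤ 2 ^ (2 * sP n a b) := (a_lt_two_pow_sP n a b).le.trans (Nat.pow_le_pow_right (by norm_num) (by omega))
  have hN : 8192 * a * EHP n a b ℓ ≤ kP n a b ℓ := le_trans (Nat.mul_le_mul_right _ (Nat.mul_le_mul (by norm_num) ha')) h
  have hR : (8192 : ℝ) * a * EHP n a b ℓ ≤ kP n a b ℓ := by exact_mod_cast hN
  have hE0 : (0 : ℝ) ≤ EHP n a b ℓ := Nat.cast_nonneg _
  have hk0 : (0 : ℝ) ≤ kP n a b ℓ := Nat.cast_nonneg _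
  clear h hN ha'
  generalize (kP n a b ℓ : ℝ) = K at hR hk0 ⊢
  generalize (EHP n a b ℓ : ℝ) = E at hR hE0 ⊢
  rw [show 3 * (1 / (4 * (a : ℝ))) * K / 2048 = 3 * K / (8192 * a) by field_simp; ring, le_div_iff₀ (by linarith)]
  nlinarith

/-- The exponent `E_2 = ℓ + τ + (kk+1)P + 12` (`ρ/4 ≥ 2^{-E_2}`). [folklore] -/
def E2P : ℕ := ℓ + τP ℓ + (kkP n a b ℓ + 1) * PP + 12

/-- `1 ≤ 2^{E_2} ρ / 4`. [folklore] -/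
theorem one_le_two_pow_E2P_mul : 1 ≤ (2 : ℝ) ^ E2P n a b ℓ * (rhoP n a b ℓ / 4) := by
  obtain ⟨D, hD⟩ : ∃ D : ℝ, D = 640 * (2 : ℝ) ^ ℓ * TP ℓ * (𝔭 : ℝ) ^ (kkP n a b ℓ + 1) := ⟨_, rfl⟩
  have hDpos : 0 < D := by rw [hD]; exact rhoDen_pos n a b ℓ
  have hρ : 1 / D ≤ rhoP n a b ℓ := by rw [hD]; exact rhoP_ge' n a b ℓ
  have hN : 4 * (640 * 2 ^ ℓ * TP ℓ * 𝔭 ^ (kkP n a b ℓ + 1)) ≤ 2 ^ E2P n a b ℓ := by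
    have hp2 : 𝔭 ^ (kkP n a b ℓ + 1) ≤ 2 ^ (PP * (kkP n a b ℓ + 1)) := by
      rw [pow_mul]; exact Nat.pow_le_pow_left (p_lt_two_pow_PP).le _
    have h1 : 640 * 2 ^ ℓ * TP ℓ * 𝔭 ^ (kkP n a b ℓ + 1) ≤ 1024 * 2 ^ ℓ * TP ℓ * 2 ^ (PP * (kkP n a b ℓ + 1)) :=
      Nat.mul_le_mul (Nat.mul_le_mul_right _ (Nat.mul_le_mul_right _ (by norm_num))) hp2
    calc 4 * (640 * 2 ^ ℓ * TP ℓ * 𝔭 ^ (kkP n a b ℓ + 1)) ≤ 4 * (1024 * 2 ^ ℓ * TP ℓ * 2 ^ (PP * (kkP n a b ℓ + 1))) := Nat.mul_le_mul_left 4 h1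
      _ = 2 ^ (12 + ℓ + τP ℓ + PP * (kkP n a b ℓ + 1)) := by
          rw [TP, show (1024 : ℕ) = 2 ^ 10 by norm_num, show (4 : ℕ) = 2 ^ 2 by norm_num, ← pow_add, ← pow_add, ← pow_add, ← pow_add]
          congr 1; ring
      _ ≤ 2 ^ E2P n a b ℓ := Nat.pow_le_pow_right (by norm_num) (by unfold E2P; nlinarith)
  have hN' : 4 * D ≤ (2 : ℝ) ^ E2P n a b ℓ := by rw [hD]; exact_mod_cast hN
  calc (1 : ℝ) = 4 * D * ((1 / D) / 4) := by field_simp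
    _ ≤ (2 : ℝ) ^ E2P n a b ℓ * ((1 / D) / 4) := mul_le_mul_of_nonneg_right hN' (div_nonneg (one_div_pos.2 hDpos).le (by norm_num))
    _ ≤ (2 : ℝ) ^ E2P n a b ℓ * (rhoP n a b ℓ / 4) := mul_le_mul_of_nonneg_left (by linarith) (pow_nonneg two_pos.le _)

/-- **(H2u)** `exp(-(k δ₁²/2048)) ≤ ρ/4`. [folklore] -/
theorem H2u_holds (ha : 1 ≤ a) : Real.exp (-(kP n a b ℓ * (1 / (4 * (a : ℝ))) ^ 2 / 2048)) ≤ rhoP n a b ℓ / 4 := by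
  refine exp_neg_le_of (E2P n a b ℓ) ?_ (one_le_two_pow_E2P_mul n a b ℓ)
  have ha0 := four_a_pos a ha
  have h := EHP_mul_le_kP n a b ℓ
  have hE2 : E2P n a b ℓ ≤ EHP n a b ℓ := by
    unfold E2P EHP; generalize (kkP n a b ℓ + 1) * PP = X; omega
  have ha' : a ^ 2 ≤ 2 ^ (2 * sP n a b) := by rw [pow_mul']; exact Nat.pow_le_pow_left (a_lt_two_pow_sP n a b).le 2
  have hN : 32768 * a ^ 2 * E2P n a b ℓ ≤ kP n a b ℓ := le_trans (Nat.mul_le_mul (Nat.mul_le_mul (by norm_num) ha') hE2) h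
  have hR : (32768 : ℝ) * a ^ 2 * E2P n a b ℓ ≤ kP n a b ℓ := by exact_mod_cast hN
  have ha2 : (0 : ℝ) < 32768 * (a : ℝ) ^ 2 := by have : (1 : ℝ) ≤ a := by exact_mod_cast ha
                                                 positivity
  have hE0 : (0 : ℝ) ≤ E2P n a b ℓ := Nat.cast_nonneg _
  clear h hN ha' hE2
  generalize (kP n a b ℓ : ℝ) = K at hR ⊢
  generalize (E2P n a b ℓ : ℝ) = E at hR hE0 ⊢
  rw [show K * (1 / (4 * (a : ℝ))) ^ 2 / 2048 = K / (32768 * a ^ 2) by field_simp; ring, le_div_iff₀ ha2]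
  nlinarith

/-- **(H3u)** `exp(-(t ρ/32)) ≤ δ₁/16`. [folklore] -/
theorem H3u_holds (ha : 1 ≤ a) : Real.exp (-(tP n a b ℓ * rhoP n a b ℓ / 32)) ≤ 1 / (4 * (a : ℝ)) / 16 := by
  have ha0 := four_a_pos a ha
  obtain ⟨D, hD⟩ : ∃ D : ℝ, D = 640 * (2 : ℝ) ^ ℓ * TP ℓ * (𝔭 : ℝ) ^ (kkP n a b ℓ + 1) := ⟨_, rfl⟩
  have hDpos : 0 < D := by rw [hD]; exact rhoDen_pos n a b ℓ
  have hρ : 1 / D ≤ rhoP n a b ℓ := by rw [hD]; exact rhoP_ge' n a b ℓ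
  refine exp_neg_le_of (sP n a b + 6) ?_ ?_
  · -- `s + 6 ≤ t ρ / 32` since `32 (s+6) · D ≤ t`
    have hN : 32 * (sP n a b + 6) * (640 * 2 ^ ℓ * TP ℓ * 𝔭 ^ (kkP n a b ℓ + 1)) ≤ tP n a b ℓ := by
      have hs6 : sP n a b + 6 ≤ 2 ^ (sP n a b + 3) := by
        have := Nat.lt_two_pow_self (n := sP n a b); rw [pow_add]; omega
      have hp1 : 𝔭 ^ (kkP n a b ℓ + 1) ≤ 2 ^ PP * 𝔭 ^ kkP n a b ℓ := by
        rw [pow_succ, mul_comm]; exact Nat.mul_le_mul_right _ (p_lt_two_pow_PP).le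
      have h1 : 640 * 2 ^ ℓ * TP ℓ * 𝔭 ^ (kkP n a b ℓ + 1) ≤ 1024 * 2 ^ ℓ * TP ℓ * (2 ^ PP * 𝔭 ^ kkP n a b ℓ) :=
        Nat.mul_le_mul (Nat.mul_le_mul_right _ (Nat.mul_le_mul_right _ (by norm_num))) hp1
      calc 32 * (sP n a b + 6) * (640 * 2 ^ ℓ * TP ℓ * 𝔭 ^ (kkP n a b ℓ + 1))
          ≤ 32 * 2 ^ (sP n a b + 3) * (1024 * 2 ^ ℓ * TP ℓ * (2 ^ PP * 𝔭 ^ kkP n a b ℓ)) := Nat.mul_le_mul (Nat.mul_le_mul_left _ hs6) h1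
        _ = 2 ^ (5 + (sP n a b + 3) + 10 + ℓ + τP ℓ + PP) * 𝔭 ^ kkP n a b ℓ := by
          rw [TP, show (1024 : ℕ) = 2 ^ 10 by norm_num, show (32 : ℕ) = 2 ^ 5 by norm_num]
          rw [pow_add 2 (5 + (sP n a b + 3) + 10 + ℓ + τP ℓ) PP, pow_add 2 (5 + (sP n a b + 3) + 10 + ℓ) (τP ℓ),
            pow_add 2 (5 + (sP n a b + 3) + 10) ℓ, pow_add 2 (5 + (sP n a b + 3)) 10, pow_add 2 5 (sP n a b + 3)]
          ring
        _ ≤ tP n a b ℓ := by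
          rw [tP]; exact Nat.mul_le_mul_right _ (Nat.pow_le_pow_right (by norm_num) (by unfold κP; omega))
    have hN' : (32 : ℝ) * ((sP n a b : ℝ) + 6) * D ≤ tP n a b ℓ := by rw [hD]; exact_mod_cast hN
    have ht0 : (0 : ℝ) ≤ tP n a b ℓ := Nat.cast_nonneg _
    rw [le_div_iff₀ (by norm_num : (0 : ℝ) < 32)]
    push_cast
    generalize (tP n a b ℓ : ℝ) = τ at hN' ht0 ⊢
    generalize (sP n a b : ℝ) = σ at hN' ⊢
    have e1 : (σ + 6) * 32 = 32 * (σ + 6) * D * (1 / D) := by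
      rw [mul_assoc (32 * (σ + 6)), mul_one_div_cancel hDpos.ne', mul_one, mul_comm]
    calc (σ + 6) * 32 = 32 * (σ + 6) * D * (1 / D) := e1
      _ ≤ τ * (1 / D) := mul_le_mul_of_nonneg_right hN' (one_div_pos.2 hDpos).le
      _ ≤ τ * rhoP n a b ℓ := mul_le_mul_of_nonneg_left hρ ht0
  · -- `1 ≤ 2^{s+6} δ₁/16` since `64 a ≤ 2^{s+6}`
    have ha' : (64 : ℝ) * a ≤ (2 : ℝ) ^ (sP n a b + 6) := by
      have h := (a_lt_two_pow_sP n a b).le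
      have h2 : 64 * a ≤ 2 ^ (sP n a b + 6) := by rw [pow_add]; omega
      exact_mod_cast h2
    rw [show (2 : ℝ) ^ (sP n a b + 6) * (1 / (4 * (a : ℝ)) / 16) = (2 : ℝ) ^ (sP n a b + 6) / (64 * a) by field_simp; ring,
      one_le_div (by linarith)]
    exact ha'

/-- `ν ≤ 1/2`. [folklore] -/
theorem nuP_le_half : nuP n a b ℓ ≤ 1 / 2 := by
  have h := two_nuP_le n a b ℓ
  have hν0 : 0 ≤ nuP n a b ℓ := by
    unfold nuP; exact div_nonneg (by exact_mod_cast Nat.zero_le _) (pow_nonneg two_pos.le _)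
  have hL1 : (1 : ℝ) ≤ ((2 ^ ℓ : ℕ) : ℝ) := by exact_mod_cast Nat.one_le_two_pow
  have hL : (1 : ℝ) / (40 * ((2 ^ ℓ : ℕ) : ℝ)) ≤ 1 / 2 := by
    rw [div_le_div_iff₀ (by positivity) two_pos]; linarith
  linarith

/-- **The analytic hypotheses hold at every level** (`a ≥ 1`). [folklore] -/
theorem lvlHyps_holds (ha : 1 ≤ a) : LvlHyps n a b ℓ where
  hν := nuP_le_half n a b ℓ
  hμ := (muP_pos n a b ℓ).le
  hm0 := reps_card_pos n a b ℓ
  hGL := hGL_holds n a b ℓ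
  H1u := H1u_holds n a b ℓ ha
  H2u := H2u_holds n a b ℓ ha
  H3u := H3u_holds n a b ℓ ha
  hθ := theta_eq n a b ℓ

end Exp

/-! ### The one-run success probability and the block-validity factor -/

section PZero

variable (n a b ℓ : ℕ)

/-- The exponent `E₀ = 4ℓ + 3τ + P + 2(kk+1)P + 36` (`p₀ ≥ 2^{-E₀}`). [folklore] -/
def E0P : ℕ := 4 * ℓ + 3 * τP ℓ + PP + 2 * ((kkP n a b ℓ + 1) * PP) + 36

/-- `1 - 2e^{-k/8} ≥ 1/2` (`k ≥ 16`). [folklore] -/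
theorem half_le_one_sub_exp : (1 / 2 : ℝ) ≤ 1 - 2 * Real.exp (-(kP n a b ℓ / 8 : ℝ)) := by
  have hk : (16 : ℝ) ≤ kP n a b ℓ := by exact_mod_cast kP_ge n a b ℓ
  have h : Real.exp (-(kP n a b ℓ / 8 : ℝ)) ≤ 1 / 4 := by
    refine exp_neg_le_of 2 ?_ (by norm_num)
    generalize (kP n a b ℓ : ℝ) = K at hk ⊢
    push_cast; linarith
  linarith

omit P in
/-- `η₁ = 1/(10L) ≥ (1/2)^{ℓ+4}`. [folklore] -/
theorem eta_ge : (1 / 2 : ℝ) ^ (ℓ + 4) ≤ 1 / (10 * (2 ^ ℓ : ℕ)) := by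
  rw [one_div, inv_pow, ← one_div, div_le_div_iff₀ (by positivity) (by positivity), one_mul, one_mul, pow_add]
  push_cast; nlinarith [pow_pos (two_pos : (0:ℝ) < 2) ℓ]

/-- `μ/2 ≥ (1/2)^{ℓ + P + τ + 7}`. [folklore] -/
theorem half_muP_ge : (1 / 2 : ℝ) ^ (ℓ + PP + τP ℓ + 7) ≤ muP n a b ℓ / 2 := by
  have h := muP_ge n a b ℓ
  push_cast at h
  have hp : (0 : ℝ) < 𝔭 := by exact_mod_cast P.prime.pos
  have hT : (0 : ℝ) < TP ℓ := by exact_mod_cast TP_pos ℓ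
  -- `2 · 20 L p 2T ≤ 2^{ℓ+P+τ+7}`
  have hN : 2 * (20 * 2 ^ ℓ * (𝔭 * (TP ℓ * 2))) ≤ 2 ^ (ℓ + PP + τP ℓ + 7) := by
    calc 2 * (20 * 2 ^ ℓ * (𝔭 * (TP ℓ * 2))) ≤ 2 * (32 * 2 ^ ℓ * (2 ^ PP * (TP ℓ * 2))) :=
          Nat.mul_le_mul_left 2 (Nat.mul_le_mul (Nat.mul_le_mul_right _ (by norm_num)) (Nat.mul_le_mul_right _ (p_lt_two_pow_PP).le))
      _ = 2 ^ (ℓ + PP + τP ℓ + 7) := by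
          rw [TP, show (32 : ℕ) = 2 ^ 5 by norm_num, pow_add, pow_add, pow_add]; ring
  have hR : (2 : ℝ) * (20 * (2 : ℝ) ^ ℓ * (𝔭 * ((TP ℓ : ℝ) * 2))) ≤ (2 : ℝ) ^ (ℓ + PP + τP ℓ + 7) := by exact_mod_cast hN
  have hD : (0 : ℝ) < 20 * (2 : ℝ) ^ ℓ * (𝔭 * ((TP ℓ : ℝ) * 2)) := mul_pos (mul_pos (by norm_num) (pow_pos two_pos _)) (mul_pos hp (mul_pos hT two_pos))
  rw [one_div, inv_pow, ← one_div, le_div_iff₀ two_pos]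
  calc 1 / (2 : ℝ) ^ (ℓ + PP + τP ℓ + 7) * 2 ≤ 1 / (20 * (2 : ℝ) ^ ℓ * (𝔭 * ((TP ℓ : ℝ) * 2))) := by
        rw [div_mul_eq_mul_div, one_mul, div_le_div_iff₀ (pow_pos two_pos _) hD, one_mul]; exact hR
    _ ≤ muP n a b ℓ := h

/-- `ρ ≥ (1/2)^{ℓ + τ + (kk+1)P + 10}`. [folklore] -/
theorem rhoP_ge_half_pow : (1 / 2 : ℝ) ^ (ℓ + τP ℓ + (kkP n a b ℓ + 1) * PP + 10) ≤ rhoP n a b ℓ := by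
  have h := rhoP_ge' n a b ℓ
  have hN : 640 * 2 ^ ℓ * TP ℓ * 𝔭 ^ (kkP n a b ℓ + 1) ≤ 2 ^ (ℓ + τP ℓ + (kkP n a b ℓ + 1) * PP + 10) := by
    have hp2 : 𝔭 ^ (kkP n a b ℓ + 1) ≤ 2 ^ ((kkP n a b ℓ + 1) * PP) := by
      rw [mul_comm, pow_mul]; exact Nat.pow_le_pow_left (p_lt_two_pow_PP).le _
    calc 640 * 2 ^ ℓ * TP ℓ * 𝔭 ^ (kkP n a b ℓ + 1) ≤ 1024 * 2 ^ ℓ * TP ℓ * 2 ^ ((kkP n a b ℓ + 1) * PP) :=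
          Nat.mul_le_mul (Nat.mul_le_mul_right _ (Nat.mul_le_mul_right _ (by norm_num))) hp2
      _ = 2 ^ (ℓ + τP ℓ + (kkP n a b ℓ + 1) * PP + 10) := by
          rw [TP, show (1024 : ℕ) = 2 ^ 10 by norm_num, pow_add, pow_add, pow_add]; ring
  have hR : (640 : ℝ) * (2 : ℝ) ^ ℓ * TP ℓ * (𝔭 : ℝ) ^ (kkP n a b ℓ + 1) ≤ (2 : ℝ) ^ (ℓ + τP ℓ + (kkP n a b ℓ + 1) * PP + 10) := by
    exact_mod_cast hN
  refine le_trans ?_ h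
  rw [one_div, inv_pow, ← one_div]
  exact div_le_div_of_nonneg_left zero_le_one (rhoDen_pos n a b ℓ) hR

/-- **`p₀ ≥ (1/2)^{E₀}`.** [folklore] -/
theorem half_pow_le_pZeroP : (1 / 2 : ℝ) ^ E0P n a b ℓ ≤ pZeroP n a b ℓ := by
  have h1 := eta_ge ℓ
  have h2 := half_muP_ge n a b ℓ
  have h3 := rhoP_ge_half_pow n a b ℓ
  have h4 := half_le_one_sub_exp n a b ℓ
  have hρ0 := (rhoP_pos n a b ℓ).le
  have hh : (0 : ℝ) ≤ 1 / 2 := by norm_num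
  -- the fourth factor
  have h5 : (1 / 2 : ℝ) ^ (ℓ + τP ℓ + (kkP n a b ℓ + 1) * PP + 14) ≤ 3 * rhoP n a b ℓ / 16 * (1 - 2 * Real.exp (-(kP n a b ℓ / 8 : ℝ))) := by
    calc (1 / 2 : ℝ) ^ (ℓ + τP ℓ + (kkP n a b ℓ + 1) * PP + 14) = (1 / 2 : ℝ) ^ (ℓ + τP ℓ + (kkP n a b ℓ + 1) * PP + 10) * (1 / 16) := by
          rw [show ℓ + τP ℓ + (kkP n a b ℓ + 1) * PP + 14 = (ℓ + τP ℓ + (kkP n a b ℓ + 1) * PP + 10) + 4 by ring, pow_add]; norm_num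
      _ ≤ rhoP n a b ℓ * (1 / 16) := mul_le_mul_of_nonneg_right h3 (by norm_num)
      _ ≤ 3 * rhoP n a b ℓ / 16 * (1 - 2 * Real.exp (-(kP n a b ℓ / 8 : ℝ))) := by nlinarith
  rw [pZeroP, show E0P n a b ℓ = (ℓ + 4) + (ℓ + PP + τP ℓ + 7) + (ℓ + τP ℓ + (kkP n a b ℓ + 1) * PP + 10) +
      (ℓ + τP ℓ + (kkP n a b ℓ + 1) * PP + 14) + 1 by unfold E0P; ring, pow_add, pow_add, pow_add, pow_add, pow_one]
  have hη0 : (0 : ℝ) ≤ 1 / (10 * (2 ^ ℓ : ℕ)) := le_trans (pow_nonneg hh _) h1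
  have hμ0 : (0 : ℝ) ≤ muP n a b ℓ / 2 := le_trans (pow_nonneg hh _) h2
  have s1 := mul_le_mul h1 h2 (pow_nonneg hh _) hη0
  have s2 := mul_le_mul s1 h3 (pow_nonneg hh _) (mul_nonneg hη0 hμ0)
  have s3 := mul_le_mul s2 h5 (pow_nonneg hh _) (mul_nonneg (mul_nonneg hη0 hμ0) hρ0)
  exact mul_le_mul_of_nonneg_right s3 hh

/-- `p₀ ≤ 1`. [folklore] -/
theorem pZeroP_le_one : pZeroP n a b ℓ ≤ 1 := by
  -- every factor is at most `1`
  have hL : (1 : ℝ) ≤ ((2 ^ ℓ : ℕ) : ℝ) := by exact_mod_cast Nat.one_le_two_pow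
  have h1 : 1 / (10 * ((2 ^ ℓ : ℕ) : ℝ)) ≤ 1 := by rw [div_le_one (by positivity)]; linarith
  have h10 : (0 : ℝ) ≤ 1 / (10 * ((2 ^ ℓ : ℕ) : ℝ)) := by positivity
  -- `μ ≤ 1/(10L)/(p 2T) ≤ 1`
  have hp : (1 : ℝ) ≤ 𝔭 := by exact_mod_cast P.prime.pos
  have hT1 : (1 : ℝ) ≤ TP ℓ := by exact_mod_cast TP_pos ℓ
  have hν0 : 0 ≤ nuP n a b ℓ := by unfold nuP; exact div_nonneg (by exact_mod_cast Nat.zero_le _) (pow_nonneg two_pos.le _)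
  have hpT0 : (0 : ℝ) ≤ 1 / (2 * (𝔭 : ℝ) ^ TP ℓ) := by have := P.prime.pos; positivity
  have hμ1 : muP n a b ℓ ≤ 1 := by
    have hden : (1 : ℝ) ≤ (𝔭 : ℝ) * ((TP ℓ * 2 : ℕ) : ℝ) := by push_cast; nlinarith
    rw [muP, div_le_one (by linarith)]
    linarith
  have hμ0 := (muP_pos n a b ℓ).le
  have hρ1 : rhoP n a b ℓ ≤ 1 := by
    have hpk : (1 : ℝ) ≤ (𝔭 : ℝ) ^ kkP n a b ℓ := one_le_pow₀ hp
    rw [rhoP, div_le_one (by positivity), div_le_iff₀ two_pos]; nlinarith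
  have hρ0 := (rhoP_pos n a b ℓ).le
  have he0 : 0 ≤ Real.exp (-(kP n a b ℓ / 8 : ℝ)) := (Real.exp_pos _).le
  have h4 : 3 * rhoP n a b ℓ / 16 * (1 - 2 * Real.exp (-(kP n a b ℓ / 8 : ℝ))) ≤ 1 := by nlinarith
  have h40 : 0 ≤ 3 * rhoP n a b ℓ / 16 * (1 - 2 * Real.exp (-(kP n a b ℓ / 8 : ℝ))) := by
    have := half_le_one_sub_exp n a b ℓ; positivity
  rw [pZeroP]
  calc 1 / (10 * ((2 ^ ℓ : ℕ) : ℝ)) * (muP n a b ℓ / 2) * rhoP n a b ℓ * (3 * rhoP n a b ℓ / 16 * (1 - 2 * Real.exp (-(kP n a b ℓ / 8 : ℝ)))) * (1 / 2)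
      ≤ 1 * 1 * 1 * 1 * 1 := by gcongr <;> linarith
    _ = 1 := by ring

/-- **All blocks valid with probability `≥ 1/2`**: `2 p · N_blocks ≤ 2^β`. [folklore] -/
theorem two_p_nBlocks_le : 2 * 𝔭 * nBlocks (κP n a b ℓ) (τP ℓ) (kkP n a b ℓ) (tP n a b ℓ) ≤ 2 ^ βP n a b ℓ := by
  have hp := (p_lt_two_pow_PP).le
  -- `t ≥ kk + 2` (`p^{kk} ≥ 2^{kk} ≥ kk + 2`… with the power-of-two prefactor `≥ 4`)
  have hkk : kkP n a b ℓ + 2 ≤ tP n a b ℓ := by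
    have h1 : kkP n a b ℓ < 2 ^ kkP n a b ℓ := Nat.lt_two_pow_self
    have h2 : 2 ^ kkP n a b ℓ ≤ KKP n a b ℓ := by rw [KKP]; exact Nat.pow_le_pow_left P.prime.two_le _
    have h3 : 4 ≤ 2 ^ (κP n a b ℓ + 3 * ℓ + 2 * τP ℓ + 4 * PP + sP n a b + 60) :=
      le_trans (by norm_num : 4 ≤ 2 ^ 2) (Nat.pow_le_pow_right (by norm_num) (by omega))
    rw [tP]
    have : (kkP n a b ℓ + 1) * 1 ≤ KKP n a b ℓ := by omega
    nlinarith
  -- `nBlocks ≤ 8 · (2T k (2t))`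
  set B := 2 ^ τP ℓ * 2 * 2 ^ κP n a b ℓ * (2 * tP n a b ℓ) with hB
  have ht1 : 1 ≤ tP n a b ℓ := by have := hkk; omega
  have hk1 : 1 ≤ 2 ^ κP n a b ℓ := Nat.one_le_two_pow
  have hT1 : 1 ≤ 2 ^ τP ℓ := Nat.one_le_two_pow
  have hNB : nBlocks (κP n a b ℓ) (τP ℓ) (kkP n a b ℓ) (tP n a b ℓ) ≤ 8 * B := by
    -- every one of the eight terms is at most `B = (2T·k)·(2t)`
    have hTk : 1 ≤ 2 ^ τP ℓ * 2 * 2 ^ κP n a b ℓ := by nlinarith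
    have h2t : 1 ≤ 2 * tP n a b ℓ := by omega
    have e1 : 2 ^ τP ℓ * 2 * 2 ^ κP n a b ℓ ≤ B := by rw [hB]; exact Nat.le_mul_of_pos_right _ (by omega)
    have e2 : 2 ^ τP ℓ * 2 ≤ B := le_trans (Nat.le_mul_of_pos_right _ (by omega)) e1
    have e3 : 2 ≤ B := le_trans (by omega) e2
    have e6 : 2 ^ κP n a b ℓ ≤ B := le_trans (Nat.le_mul_of_pos_left _ (by omega)) e1
    have e4 : kkP n a b ℓ * 2 ^ κP n a b ℓ ≤ B := by
      rw [hB, show 2 ^ τP ℓ * 2 * 2 ^ κP n a b ℓ * (2 * tP n a b ℓ) = (2 * tP n a b ℓ * (2 ^ τP ℓ * 2)) * 2 ^ κP n a b ℓ by ring]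
      exact Nat.mul_le_mul_right _ (le_trans (by omega) (Nat.le_mul_of_pos_right _ (by omega)))
    have e5 : kkP n a b ℓ ≤ B := le_trans (Nat.le_mul_of_pos_right _ hk1) e4
    have e7 : tP n a b ℓ * 2 ^ κP n a b ℓ ≤ B := by
      rw [hB, show 2 ^ τP ℓ * 2 * 2 ^ κP n a b ℓ * (2 * tP n a b ℓ) = (2 * tP n a b ℓ * (2 ^ τP ℓ * 2)) * 2 ^ κP n a b ℓ by ring]
      exact Nat.mul_le_mul_right _ (le_trans (by omega) (Nat.le_mul_of_pos_right _ (by omega)))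
    have e8 : 1 ≤ B := le_trans (by omega) e3
    rw [nBlocks]; omega
  calc 2 * 𝔭 * nBlocks (κP n a b ℓ) (τP ℓ) (kkP n a b ℓ) (tP n a b ℓ) ≤ 2 * 2 ^ PP * (8 * B) := Nat.mul_le_mul (Nat.mul_le_mul_left 2 hp) hNB
    _ = 2 ^ (PP + τP ℓ + κP n a b ℓ + 6 + (κP n a b ℓ + 3 * ℓ + 2 * τP ℓ + 4 * PP + sP n a b + 60)) * 𝔭 ^ kkP n a b ℓ := by
        rw [hB, tP, KKP, show (8 : ℕ) = 2 ^ 3 by norm_num, pow_add 2 (PP + τP ℓ + κP n a b ℓ + 6), pow_add 2 (PP + τP ℓ + κP n a b ℓ) 6,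
          pow_add 2 (PP + τP ℓ) (κP n a b ℓ), pow_add 2 PP (τP ℓ)]
        ring
    _ ≤ 2 ^ (PP + τP ℓ + κP n a b ℓ + 6 + (κP n a b ℓ + 3 * ℓ + 2 * τP ℓ + 4 * PP + sP n a b + 60)) * 2 ^ (kkP n a b ℓ * PP) := by
        refine Nat.mul_le_mul_left _ ?_
        rw [mul_comm, pow_mul]; exact Nat.pow_le_pow_left hp _
    _ = 2 ^ (PP + τP ℓ + κP n a b ℓ + 6 + (κP n a b ℓ + 3 * ℓ + 2 * τP ℓ + 4 * PP + sP n a b + 60) + kkP n a b ℓ * PP) := by rw [← pow_add]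
    _ ≤ 2 ^ βP n a b ℓ := Nat.pow_le_pow_right (by norm_num) (by unfold βP; generalize kkP n a b ℓ * PP = X; omega)

/-- **The block-validity factor is at least `1/2`.** [folklore] -/
theorem validFrac_ge_half : (1 / 2 : ℝ) ≤ 1 - (𝔭 : ℝ) * nBlocks (κP n a b ℓ) (τP ℓ) (kkP n a b ℓ) (tP n a b ℓ) / (2 : ℝ) ^ βP n a b ℓ := by
  have h := two_p_nBlocks_le n a b ℓ
  have hR : (2 : ℝ) * 𝔭 * nBlocks (κP n a b ℓ) (τP ℓ) (kkP n a b ℓ) (tP n a b ℓ) ≤ (2 : ℝ) ^ βP n a b ℓ := by exact_mod_cast h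
  have hβ : (0 : ℝ) < (2 : ℝ) ^ βP n a b ℓ := pow_pos two_pos _
  generalize (nBlocks (κP n a b ℓ) (τP ℓ) (kkP n a b ℓ) (tP n a b ℓ) : ℝ) = N at hR ⊢
  generalize (2 : ℝ) ^ βP n a b ℓ = B at hR hβ ⊢
  have hp0 : (0 : ℝ) ≤ 𝔭 := Nat.cast_nonneg _
  have : (𝔭 : ℝ) * N / B ≤ 1 / 2 := by rw [div_le_iff₀ hβ]; linarith
  linarith

/-- **The effective one-run success probability** `p₀' = p₀ · (validity factor) ≥ (1/2)^{E₀+1}`. [folklore] -/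
theorem half_pow_le_pZeroP' : (1 / 2 : ℝ) ^ (E0P n a b ℓ + 1) ≤
    pZeroP n a b ℓ * (1 - (𝔭 : ℝ) * nBlocks (κP n a b ℓ) (τP ℓ) (kkP n a b ℓ) (tP n a b ℓ) / (2 : ℝ) ^ βP n a b ℓ) := by
  rw [pow_succ]
  exact mul_le_mul (half_pow_le_pZeroP n a b ℓ) (validFrac_ge_half n a b ℓ) (by norm_num) (le_trans (pow_nonneg (by norm_num) _) (half_pow_le_pZeroP n a b ℓ))

end PZero

/-! ### The repetition and validation budgets -/

section RepVal

variable (n a b ℓ : ℕ)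

/-- **The repetition bound**: `(1 - p₀')^{Reps} ≤ 1/(4b)` (`b ≥ 1`).
[cite: CarmosinoImpagliazzoKabanetsKolokolova2016, Thm. 5.1 (proof: repetition)] -/
theorem rep_boundP (hb : 1 ≤ b) {q : ℝ} (hq : (1 / 2 : ℝ) ^ (E0P n a b ℓ + 1) ≤ q) (hq1 : q ≤ 1) :
    (1 - q) ^ RepsP n a b ℓ ≤ 1 / (4 * b) := by
  have hbs := b_lt_two_pow_sP n a b
  obtain ⟨m, hm⟩ : ∃ m, E0P n a b ℓ + 1 = m := ⟨_, rfl⟩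
  obtain ⟨s, hs⟩ : ∃ s, sP n a b = s := ⟨_, rfl⟩
  have hRe : m + (s + 6) ≤ repsExpP n a b ℓ := by
    rw [← hm, ← hs]; unfold E0P repsExpP; generalize kkP n a b ℓ = K; nlinarith [two_le_PP]
  obtain ⟨E, hE⟩ : ∃ E, repsExpP n a b ℓ = E := ⟨_, rfl⟩
  rw [hm] at hq; rw [hs] at hbs; rw [hE] at hRe
  rw [RepsP, hE]
  have hb' : (0 : ℝ) < b := by exact_mod_cast hb
  have hq0 : (0 : ℝ) ≤ 1 - (1 / 2) ^ m := by
    have : (1 / 2 : ℝ) ^ m ≤ 1 := pow_le_one₀ (by norm_num) (by norm_num)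
    linarith
  -- `(1-q)^R ≤ (1 - 2^{-m})^R ≤ exp(-2^{-m} R) ≤ exp(-2^{s+6})`
  calc (1 - q) ^ 2 ^ E ≤ (1 - (1 / 2 : ℝ) ^ m) ^ 2 ^ E := pow_le_pow_left₀ (by linarith) (by linarith) _
    _ ≤ (Real.exp (-(1 / 2 : ℝ) ^ m)) ^ 2 ^ E := pow_le_pow_left₀ hq0 (Real.one_sub_le_exp_neg _) _
    _ = Real.exp (-((1 / 2 : ℝ) ^ m * 2 ^ E)) := by rw [← Real.exp_nat_mul]; push_cast; ring_nf
    _ ≤ Real.exp (-((2 : ℝ) ^ (s + 6))) := by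
        rw [Real.exp_le_exp, neg_le_neg_iff]
        have hsplit : (2 : ℝ) ^ E = 2 ^ m * 2 ^ (E - m) := by rw [← pow_add]; congr 1; omega
        rw [hsplit, one_div, inv_pow, ← mul_assoc, inv_mul_cancel₀ (pow_ne_zero m two_ne_zero), one_mul]
        exact pow_le_pow_right₀ (by norm_num) (by omega)
    _ ≤ 1 / (4 * b) := by
        refine exp_neg_le_of (s + 2) ?_ ?_
        · have : s + 2 ≤ 2 ^ (s + 6) := by have := succ_le_two_pow' (s + 6); omega
          exact_mod_cast this
        · have : 4 * b ≤ 2 ^ (s + 2) := by rw [pow_add]; omega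
          have hR : (4 * b : ℝ) ≤ 2 ^ (s + 2) := by exact_mod_cast this
          rw [mul_one_div, le_div_iff₀ (by positivity), one_mul]; exact hR

/-- **The validation bound, one level**: `Reps·2e^{-2M/(16a²)} ≤ (1/(4b))·(1/2)^{ℓ+1}`.
[cite: CarmosinoImpagliazzoKabanetsKolokolova2016, Thm. 5.1 (proof: validation)] -/
theorem val_bound_levelP (ha : 1 ≤ a) (hb : 1 ≤ b) :
    (RepsP n a b ℓ : ℝ) * (2 * Real.exp (-2 * MP n a b ℓ * (1 / (4 * a)) ^ 2)) ≤ 1 / (4 * b) * (1 / 2) ^ (ℓ + 1) := by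
  have has := a_lt_two_pow_sP n a b
  have hbs := b_lt_two_pow_sP n a b
  have hEℓ : ℓ ≤ repsExpP n a b ℓ := by unfold repsExpP; omega
  obtain ⟨s, hs⟩ : ∃ s, sP n a b = s := ⟨_, rfl⟩
  obtain ⟨E, hE⟩ : ∃ E, repsExpP n a b ℓ = E := ⟨_, rfl⟩
  obtain ⟨m₄, hm₄⟩ : ∃ m, E + 2 * s + 8 = m := ⟨_, rfl⟩
  have hReps : RepsP n a b ℓ = 2 ^ E := by rw [RepsP, hE]
  have hM : MP n a b ℓ = 64 * 4 ^ s * m₄ := by rw [MP, hE, hs, hm₄]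
  rw [hs] at has hbs; rw [hE] at hEℓ
  have ha' : (0 : ℝ) < a := by exact_mod_cast ha
  have hb' : (0 : ℝ) < b := by exact_mod_cast hb
  -- `exp(-2M/(16a²)) ≤ (1/2)^{8 m₄} ≤ (1/2)^{m₄ + …}`
  have hexp : Real.exp (-2 * MP n a b ℓ * (1 / (4 * a)) ^ 2) ≤ (1 / 2) ^ (8 * m₄) := by
    rw [show -2 * (MP n a b ℓ : ℝ) * (1 / (4 * a)) ^ 2 = -(MP n a b ℓ / (8 * (a * a))) by field_simp; ring]
    apply exp_neg_le_half_pow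
    have hnat : 8 * m₄ * (8 * (a * a)) ≤ MP n a b ℓ := by
      rw [hM]
      have haa : a * a ≤ 2 ^ s * 2 ^ s := Nat.mul_le_mul has.le has.le
      rw [show (4 : ℕ) ^ s = 2 ^ s * 2 ^ s by rw [← mul_pow]; norm_num]
      calc 8 * m₄ * (8 * (a * a)) ≤ 8 * m₄ * (8 * (2 ^ s * 2 ^ s)) := Nat.mul_le_mul_left _ (Nat.mul_le_mul_left _ haa)
        _ = 64 * (2 ^ s * 2 ^ s) * m₄ := by ring
    have hR : (8 * m₄ * (8 * (a * a)) : ℝ) ≤ MP n a b ℓ := by exact_mod_cast hnat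
    rw [le_div_iff₀ (by positivity)]; push_cast at hR ⊢; linarith
  -- bookkeeping: `2^E · 2 · 2^{ℓ+1} · 4b ≤ 2^{8 m₄}`
  have hnat : 2 ^ E * 2 * (2 ^ (ℓ + 1) * (4 * b)) ≤ 2 ^ (8 * m₄) := by
    calc 2 ^ E * 2 * (2 ^ (ℓ + 1) * (4 * b)) ≤ 2 ^ E * 2 * (2 ^ (ℓ + 1) * (4 * 2 ^ s)) :=
          Nat.mul_le_mul_left _ (Nat.mul_le_mul_left _ (Nat.mul_le_mul_left _ hbs.le))
      _ = 2 ^ (E + ℓ + s + 4) := by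
          rw [show (4 : ℕ) = 2 ^ 2 by norm_num, ← pow_succ, ← pow_add, ← pow_add, ← pow_add]
          exact congrArg (fun e => 2 ^ e) (by omega)
      _ ≤ 2 ^ (8 * m₄) := Nat.pow_le_pow_right (by norm_num) (by omega)
  have hR : (2 ^ E * 2 * (2 ^ (ℓ + 1) * (4 * b)) : ℝ) ≤ 2 ^ (8 * m₄) := by exact_mod_cast hnat
  rw [hReps]; push_cast
  have h2m : (0 : ℝ) < 2 ^ (8 * m₄) := by positivity
  calc (2 : ℝ) ^ E * (2 * Real.exp (-2 * MP n a b ℓ * (1 / (4 * a)) ^ 2)) ≤ 2 ^ E * (2 * (1 / 2) ^ (8 * m₄)) := by gcongr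
    _ ≤ 1 / (4 * b) * (1 / 2) ^ (ℓ + 1) := by
        rw [show (2 : ℝ) ^ E * (2 * (1 / 2) ^ (8 * m₄)) = (2 ^ E * 2) / 2 ^ (8 * m₄) by rw [one_div, inv_pow]; ring,
          show 1 / (4 * (b : ℝ)) * (1 / 2) ^ (ℓ + 1) = 1 / (2 ^ (ℓ + 1) * (4 * b)) by
            rw [one_div (2 : ℝ), inv_pow, ← one_div, one_div_mul_one_div, mul_comm],
          div_le_div_iff₀ h2m (by positivity), one_mul]
        exact hR

/-- **The validation bound**: `Σ_{ℓ ≤ ℓg} Reps(ℓ)·2e^{-2M(ℓ)/(16a²)} ≤ 1/(4b)`.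
[cite: CarmosinoImpagliazzoKabanetsKolokolova2016, Thm. 5.1 (proof: validation)] -/
theorem val_boundP (ha : 1 ≤ a) (hb : 1 ≤ b) (ℓg : ℕ) :
    ∑ ℓ ∈ Finset.range (ℓg + 1), (RepsP n a b ℓ : ℝ) * (2 * Real.exp (-2 * MP n a b ℓ * (1 / (4 * a)) ^ 2)) ≤ 1 / (4 * b) := by
  have hb' : (0 : ℝ) < b := by exact_mod_cast hb
  calc ∑ ℓ ∈ Finset.range (ℓg + 1), (RepsP n a b ℓ : ℝ) * (2 * Real.exp (-2 * MP n a b ℓ * (1 / (4 * a)) ^ 2))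
      ≤ ∑ ℓ ∈ Finset.range (ℓg + 1), (1 / (4 * (b : ℝ)) * (1 / 2 : ℝ) ^ (ℓ + 1)) :=
        Finset.sum_le_sum fun ℓ _ => val_bound_levelP n a b ℓ ha hb
    _ = 1 / (4 * (b : ℝ)) * ((1 / 2 : ℝ) * ∑ ℓ ∈ Finset.range (ℓg + 1), (1 / 2 : ℝ) ^ ℓ) := by
        rw [Finset.mul_sum, Finset.mul_sum]
        refine Finset.sum_congr rfl fun ℓ _ => ?_
        rw [pow_succ]; ring
    _ ≤ 1 / (4 * (b : ℝ)) * ((1 / 2 : ℝ) * 2) := by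
        gcongr
        exact sum_geometric_two_le _
    _ = 1 / (4 * (b : ℝ)) := by ring

end RepVal

end Modp

end Literature.Computability.Learning


/-!
## Part — The `AC⁰[p]` learner: an explicit good level

Analysis for the named fact `Literature.Computability.Learning.cikk_learn_AC0Mod` (CIKK 2016,
Cor. 5.4). The usefulness argument (`LevelP.GoodLevelP d k₀ n a b ℓ`) needs a degree scale `ℓ'`
with `16 · ampPSize(…) < p^{ℓ'}` and `64((p-1)ℓ')^{2(d+11)} ≤ oddFloor ℓ`. Here:

* `sixteen_ampPSize_lt`: a generic bound `16 · ampPSize n k β T ℓ te p s_c < 2^{ℓ'}` with `ℓ'` the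
  sum of the bit sizes of the parameters (`ellP`);
* `ellP_le`: at the level parameters, `ℓ' ≤ A + B · size ℓ` with `A, B` explicit in `s, P, k₀`
  (`ellA`, `ellB`);
* the explicit good level `goodLvlP d k₀ n a b = 2^{mP}` (`goodLvlP_good`), with
  `mP = 4D'(size G + 8D' + 4)`, `D' = 2(d+11)`, `G = 64 (2^P (A+B))^{D'}`.

## References

* M. Carmosino, R. Impagliazzo, V. Kabanets, A. Kolokolova, *Learning algorithms from natural
  proofs*, CCC 2016, Lem. 3.4, Thm. 5.1, Cor. 5.4 [CarmosinoImpagliazzoKabanetsKolokolova2016].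
-/

namespace Literature.Computability.Learning

namespace Modp

open Literature.Computability.Complexity Literature.Computability.MetaComplexity Literature.Computability.MetaComplexity.Smolensky
  Literature.Computability.MetaComplexity.GFDesign Literature.Computability.Cryptography _root_.Computability Finset

/-! ### A generic bound on the NW output circuit size -/

section AmpBound

variable {n k β T ℓ te p sc : ℕ}

/-- `x ≤ 2^{size x}`. [folklore] -/
theorem le_two_pow_size (x : ℕ) : x ≤ 2 ^ Nat.size x := (Nat.lt_size_self x).le

/-- `vnSize T p ≤ 9 T² (p+1)²` (`T ≥ 1`). [folklore] -/
theorem vnSize_le (hT : 1 ≤ T) (p : ℕ) : vnSize T p ≤ 9 * (T ^ 2 * (p + 1) ^ 2) := by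
  set X := T ^ 2 * (p + 1) ^ 2 with hX
  have hp1 : 1 ≤ p + 1 := by omega
  have hX1 : T * (p + 1) ≤ X := by
    rw [hX, pow_two, pow_two]; calc T * (p + 1) = T * 1 * ((p + 1) * 1) := by ring
      _ ≤ T * T * ((p + 1) * (p + 1)) := Nat.mul_le_mul (Nat.mul_le_mul_left _ hT) (Nat.mul_le_mul_left _ hp1)
  have hX2 : T * (T * (p + 1)) ≤ X := by
    rw [hX, pow_two, pow_two]; calc T * (T * (p + 1)) = T * T * ((p + 1) * 1) := by ring
      _ ≤ T * T * ((p + 1) * (p + 1)) := Nat.mul_le_mul_left _ (Nat.mul_le_mul_left _ hp1)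
  have hX3 : T * (p * p * 3 + 3) ≤ 3 * X := by
    have h : p * p * 3 + 3 ≤ 3 * ((p + 1) * (p + 1)) := by
      have e2 : (p + 1) * (p + 1) = p * p + 2 * p + 1 := by ring
      rw [e2]; omega
    rw [hX, pow_two, pow_two]
    calc T * (p * p * 3 + 3) ≤ T * (3 * ((p + 1) * (p + 1))) := Nat.mul_le_mul_left _ h
      _ = 3 * (T * 1 * ((p + 1) * (p + 1))) := by ring
      _ ≤ 3 * (T * T * ((p + 1) * (p + 1))) := Nat.mul_le_mul_left 3 (Nat.mul_le_mul_right _ (Nat.mul_le_mul_left _ hT))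
  have hX4 : 1 ≤ X := by rw [hX]; exact Nat.mul_le_mul (Nat.one_le_pow _ _ hT) (Nat.one_le_pow _ _ hp1)
  have e : vnSize T p = T * (p + 1) + T * (T * (p + 1)) + T * (p * p * 3 + 3) + 2 := by rw [vnSize]; ring
  calc vnSize T p = T * (p + 1) + T * (T * (p + 1)) + T * (p * p * 3 + 3) + 2 := e
    _ ≤ X + X + 3 * X + 2 * X := add_le_add (add_le_add (add_le_add hX1 hX2) hX3) (by omega)
    _ ≤ 9 * X := by omega

/-- **`ampPSize ≤ 27 T² (p+1)² · kβ(n+1)(s_c+1) · p^{te} te (ℓ+1)(p+1)`** (`k, β, T, te ≥ 1`, `p ≥ 2`). [folklore] -/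
theorem ampPSize_le (hk : 1 ≤ k) (hβ : 1 ≤ β) (hT : 1 ≤ T) (hte : 1 ≤ te) (hp : 2 ≤ p) :
    ampPSize n k β T ℓ te p sc ≤ 27 * (T ^ 2 * (p + 1) ^ 2) * (k * β * (n + 1) * (sc + 1) * (p ^ te * te * (ℓ + 1) * (p + 1))) := by
  obtain ⟨E, hE⟩ : ∃ E, E = p ^ te * te * (ℓ + 1) * (p + 1) := ⟨_, rfl⟩
  obtain ⟨F, hF⟩ : ∃ F, F = k * β * (n + 1) * (sc + 1) * E := ⟨_, rfl⟩
  rw [← hE, ← hF]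
  have hQ : 1 ≤ p ^ te := Nat.one_le_pow _ _ (by omega)
  have hp1 : 1 ≤ p + 1 := by omega
  have hℓ1 : 1 ≤ ℓ + 1 := by omega
  have hM : 1 ≤ te * (ℓ + 1) * (p + 1) := by
    calc (1 : ℕ) = 1 * 1 * 1 := by ring
      _ ≤ te * (ℓ + 1) * (p + 1) := Nat.mul_le_mul (Nat.mul_le_mul hte hℓ1) hp1
  have hEM : te * (ℓ + 1) * (p + 1) ≤ E := by
    rw [hE]; calc te * (ℓ + 1) * (p + 1) = 1 * (te * (ℓ + 1) * (p + 1)) := by ring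
      _ ≤ p ^ te * (te * (ℓ + 1) * (p + 1)) := Nat.mul_le_mul_right _ hQ
      _ = p ^ te * te * (ℓ + 1) * (p + 1) := by ring
  have hE1 : p + 1 ≤ E := by
    refine le_trans ?_ hEM
    calc p + 1 = 1 * 1 * (p + 1) := by ring
      _ ≤ te * (ℓ + 1) * (p + 1) := Nat.mul_le_mul_right _ (Nat.mul_le_mul hte hℓ1)
  have hkβ : 1 ≤ k * β := Nat.mul_le_mul hk hβ
  have hF1 : k * β * E ≤ F := by
    rw [hF]; calc k * β * E = k * β * 1 * 1 * E := by ring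
      _ ≤ k * β * (n + 1) * (sc + 1) * E := Nat.mul_le_mul_right _ (Nat.mul_le_mul (Nat.mul_le_mul_left _ (by omega)) (by omega))
  have hF2 : k * β * (sc + 1) ≤ F := by
    rw [hF]; calc k * β * (sc + 1) = k * β * 1 * (sc + 1) * 1 := by ring
      _ ≤ k * β * (n + 1) * (sc + 1) * E := Nat.mul_le_mul (Nat.mul_le_mul_right _ (Nat.mul_le_mul_left _ (by omega))) (le_trans hp1 hE1)
  have hF3 : k * β * (p + 1) ≤ F := le_trans (Nat.mul_le_mul_left _ hE1) hF1
  have hFpos : 1 ≤ F := le_trans (Nat.mul_le_mul hkβ hp1) hF3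
  -- `eqTestSize + 1 ≤ 3 te (ℓ+1)(p+1)`
  have heq : eqTestSize te ℓ p + 1 ≤ 3 * (te * (ℓ + 1) * (p + 1)) := by
    rw [eqTestSize]
    obtain ⟨q, rfl⟩ : ∃ q, p = q + 2 := ⟨p - 2, by omega⟩
    rw [show q + 2 - 1 = q + 1 by omega]
    have h1 : (ℓ + 1) * (q + 1) + 2 ≤ (ℓ + 1) * (q + 2 + 1) := by nlinarith
    have h2 : te * ((ℓ + 1) * (q + 1) + 2) ≤ te * ((ℓ + 1) * (q + 2 + 1)) := Nat.mul_le_mul_left te h1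
    have h3 : te * ((ℓ + 1) * (q + 2 + 1)) = te * (ℓ + 1) * (q + 2 + 1) := by ring
    omega
  -- `coordSize ≤ 4E`
  have hco : coordSize (p ^ te) te ℓ p ≤ 4 * E := by
    rw [coordSize]
    have h1 : p ^ te * (eqTestSize te ℓ p + 1) ≤ p ^ te * (3 * (te * (ℓ + 1) * (p + 1))) := Nat.mul_le_mul_left _ heq
    have h2 : p ^ te * (3 * (te * (ℓ + 1) * (p + 1))) = 3 * E := by rw [hE]; ring
    have h3 : 1 ≤ E := le_trans hp1 hE1
    omega
  -- `indSize ≤ 9F`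
  have hind : indSize n k β ℓ te p sc ≤ 9 * F := by
    rw [indSize]
    have t1 : (k * β + 1) * (p - 1) ≤ 2 * (k * β * (p + 1)) := by
      calc (k * β + 1) * (p - 1) ≤ (2 * (k * β)) * (p + 1) := Nat.mul_le_mul (by omega) (by omega)
        _ = 2 * (k * β * (p + 1)) := by ring
    have t3 : coordSize (p ^ te) te ℓ p + (sc + n * coordSize (p ^ te) te ℓ p) + 1 ≤ (n + 1) * (4 * E) + (sc + 1) := by
      have := Nat.mul_le_mul_left n hco
      have e : (n + 1) * (4 * E) = 4 * E + n * (4 * E) := by ring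
      omega
    have t4 : k * β * ((n + 1) * (4 * E) + (sc + 1)) ≤ 4 * F + F := by
      rw [Nat.mul_add]
      refine add_le_add ?_ hF2
      rw [hF]; calc k * β * ((n + 1) * (4 * E)) = 4 * (k * β * (n + 1) * 1 * E) := by ring
        _ ≤ 4 * (k * β * (n + 1) * (sc + 1) * E) := Nat.mul_le_mul_left 4 (Nat.mul_le_mul_right _ (Nat.mul_le_mul_left _ (by omega)))
    have t5 := Nat.mul_le_mul_left (k * β) t3
    omega
  have hvn := vnSize_le hT p
  -- assemble
  rw [ampPSize]
  have hTp : T * p ≤ T ^ 2 * (p + 1) ^ 2 := by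
    rw [pow_two, pow_two]; calc T * p = T * 1 * (p * 1) := by ring
      _ ≤ T * T * ((p + 1) * (p + 1)) := Nat.mul_le_mul (Nat.mul_le_mul_left _ hT) (Nat.mul_le_mul (by omega) hp1)
  obtain ⟨W, hW⟩ : ∃ W, W = T ^ 2 * (p + 1) ^ 2 * F := ⟨_, rfl⟩
  have s1 : vnSize T p ≤ 9 * W := by rw [hW, ← Nat.mul_assoc]; exact hvn.trans (Nat.le_mul_of_pos_right _ hFpos)
  have s2 : T * 2 * p * indSize n k β ℓ te p sc ≤ 18 * W := by
    calc T * 2 * p * indSize n k β ℓ te p sc ≤ T * 2 * p * (9 * F) := Nat.mul_le_mul_left _ hind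
      _ = 18 * (T * p * F) := by ring
      _ ≤ 18 * W := by rw [hW]; exact Nat.mul_le_mul_left _ (Nat.mul_le_mul_right _ hTp)
  rw [Nat.mul_assoc 27, ← hW]
  omega

/-- The degree scale `ℓ'`: nine plus the bit sizes of the factors of the size bound. [folklore] -/
def ellP (n k β T ℓ te p sc : ℕ) : ℕ :=
  9 + 2 * Nat.size T + 3 * Nat.size (p + 1) + Nat.size k + Nat.size β + Nat.size (n + 1) + Nat.size (sc + 1) +
    Nat.size (p ^ te) + Nat.size te + Nat.size (ℓ + 1)

/-- **`16 · ampPSize < 2^{ℓ'}`.** [folklore] -/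
theorem sixteen_ampPSize_lt (hk : 1 ≤ k) (hβ : 1 ≤ β) (hT : 1 ≤ T) (hte : 1 ≤ te) (hp : 2 ≤ p) :
    16 * ampPSize n k β T ℓ te p sc < 2 ^ ellP n k β T ℓ te p sc := by
  have h := ampPSize_le (n := n) (ℓ := ℓ) (sc := sc) hk hβ hT hte hp
  have hprod : T ^ 2 * (p + 1) ^ 2 * (k * β * (n + 1) * (sc + 1) * (p ^ te * te * (ℓ + 1) * (p + 1))) ≤
      2 ^ (2 * Nat.size T + 3 * Nat.size (p + 1) + Nat.size k + Nat.size β + Nat.size (n + 1) + Nat.size (sc + 1) +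
        Nat.size (p ^ te) + Nat.size te + Nat.size (ℓ + 1)) := by
    have eT : T ^ 2 ≤ 2 ^ (2 * Nat.size T) := by rw [pow_mul']; exact Nat.pow_le_pow_left (le_two_pow_size T) 2
    have ep2 : (p + 1) ^ 2 ≤ 2 ^ (2 * Nat.size (p + 1)) := by rw [pow_mul']; exact Nat.pow_le_pow_left (le_two_pow_size _) 2
    have e := Nat.mul_le_mul (Nat.mul_le_mul eT ep2)
      (Nat.mul_le_mul (Nat.mul_le_mul (Nat.mul_le_mul (Nat.mul_le_mul (le_two_pow_size k) (le_two_pow_size β)) (le_two_pow_size (n + 1)))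
        (le_two_pow_size (sc + 1)))
        (Nat.mul_le_mul (Nat.mul_le_mul (Nat.mul_le_mul (le_two_pow_size (p ^ te)) (le_two_pow_size te)) (le_two_pow_size (ℓ + 1))) (le_two_pow_size (p + 1))))
    refine e.trans (le_of_eq ?_)
    simp only [← pow_add]
    congr 1; ring
  calc 16 * ampPSize n k β T ℓ te p sc ≤ 16 * (27 * (T ^ 2 * (p + 1) ^ 2) * (k * β * (n + 1) * (sc + 1) * (p ^ te * te * (ℓ + 1) * (p + 1)))) :=
        Nat.mul_le_mul_left 16 h
    _ < 512 * (T ^ 2 * (p + 1) ^ 2 * (k * β * (n + 1) * (sc + 1) * (p ^ te * te * (ℓ + 1) * (p + 1)))) := by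
        have hQ : 1 ≤ p ^ te := Nat.one_le_pow _ _ (by omega)
        have : 1 ≤ T ^ 2 * (p + 1) ^ 2 * (k * β * (n + 1) * (sc + 1) * (p ^ te * te * (ℓ + 1) * (p + 1))) := by
          calc (1 : ℕ) = 1 * 1 * (1 * 1 * 1 * 1 * (1 * 1 * 1 * 1)) := by ring
            _ ≤ T ^ 2 * (p + 1) ^ 2 * (k * β * (n + 1) * (sc + 1) * (p ^ te * te * (ℓ + 1) * (p + 1))) :=
              Nat.mul_le_mul (Nat.mul_le_mul (Nat.one_le_pow _ _ hT) (Nat.one_le_pow _ _ (by omega)))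
                (Nat.mul_le_mul (Nat.mul_le_mul (Nat.mul_le_mul (Nat.mul_le_mul hk hβ) (by omega)) (by omega))
                  (Nat.mul_le_mul (Nat.mul_le_mul (Nat.mul_le_mul hQ hte) (by omega)) (by omega)))
        rw [Nat.mul_assoc 27]
        omega
    _ ≤ 512 * 2 ^ (2 * Nat.size T + 3 * Nat.size (p + 1) + Nat.size k + Nat.size β + Nat.size (n + 1) + Nat.size (sc + 1) +
        Nat.size (p ^ te) + Nat.size te + Nat.size (ℓ + 1)) := Nat.mul_le_mul_left _ hprod
    _ = 2 ^ ellP n k β T ℓ te p sc := by rw [ellP, show (512 : ℕ) = 2 ^ 9 by norm_num, ← pow_add]; congr 1; ring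

end AmpBound

/-! ### The degree scale at the level parameters is linear in `size ℓ` -/

section EllBound

variable [P : PrimeP] (k₀ n a b ℓ : ℕ)

/-- The degree scale at level `ℓ` for targets of size `n^{k₀} + k₀`. [folklore] -/
def ellLvl : ℕ := ellP n (kP n a b ℓ) (βP n a b ℓ) (TP ℓ) ℓ (teP n a b ℓ) 𝔭 (n ^ k₀ + k₀)

/-- The slope `B = 8 + 6(P+1)`. [folklore] -/
def ellB : ℕ := 8 + 6 * (PP + 1)

/-- The intercept `A = 148 + 21P + 7s + s k₀ + k₀ + (P+1)(7s + 17P + 129)`. [folklore] -/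
def ellA : ℕ := 148 + 21 * PP + 7 * sP n a b + sP n a b * k₀ + k₀ + (PP + 1) * (7 * sP n a b + 17 * PP + 129)

/-- `size kk ≤ 4·size ℓ + 3s + 11P + 80`. [folklore] -/
theorem size_kkP_le : Nat.size (kkP n a b ℓ) ≤ 4 * Nat.size ℓ + 3 * sP n a b + 11 * PP + 80 := by
  rw [Nat.size_le]
  have hℓ : ℓ < 2 ^ Nat.size ℓ := Nat.lt_size_self ℓ
  have hV : 3 * sP n a b + 3 * Nat.size ℓ + 11 * PP + 78 < 2 ^ (3 * sP n a b + 3 * Nat.size ℓ + 11 * PP + 78) := Nat.lt_two_pow_self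
  have e : kkP n a b ℓ = 2 * ℓ + (3 * sP n a b + 3 * Nat.size ℓ + 11 * PP + 78) := by unfold kkP κP τP; ring
  rw [e]
  calc 2 * ℓ + (3 * sP n a b + 3 * Nat.size ℓ + 11 * PP + 78) < 2 ^ (Nat.size ℓ + 1) + 2 ^ (3 * sP n a b + 3 * Nat.size ℓ + 11 * PP + 78) := by
        rw [pow_succ]; omega
    _ ≤ 2 ^ (Nat.size ℓ + 1 + (3 * sP n a b + 3 * Nat.size ℓ + 11 * PP + 78) + 1) := two_pow_add_two_pow_le _ _
    _ = 2 ^ (4 * Nat.size ℓ + 3 * sP n a b + 11 * PP + 80) := by congr 1; ring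

/-- `size β ≤ 4·size ℓ + 3s + 12P + 82`. [folklore] -/
theorem size_βP_le : Nat.size (βP n a b ℓ) ≤ 4 * Nat.size ℓ + 3 * sP n a b + 12 * PP + 82 := by
  have hkk := size_kkP_le n a b ℓ
  have hkklt : kkP n a b ℓ < 2 ^ Nat.size (kkP n a b ℓ) := Nat.lt_size_self _
  have hP4 : PP + 4 ≤ 2 ^ (PP + 2) := by
    have := Nat.lt_two_pow_self (n := PP); rw [pow_add]; omega
  rw [Nat.size_le]
  -- `β ≤ kk (P + 4)`
  have hβ : βP n a b ℓ ≤ kkP n a b ℓ * (PP + 4) := by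
    have hs : sP n a b ≤ κP n a b ℓ := by unfold κP; omega
    unfold βP kkP at *
    nlinarith
  calc βP n a b ℓ ≤ kkP n a b ℓ * (PP + 4) := hβ
    _ < 2 ^ Nat.size (kkP n a b ℓ) * 2 ^ (PP + 2) := by
        have h0 : 0 < 2 ^ (PP + 2) := Nat.two_pow_pos _
        calc kkP n a b ℓ * (PP + 4) ≤ kkP n a b ℓ * 2 ^ (PP + 2) := Nat.mul_le_mul_left _ hP4
          _ < 2 ^ Nat.size (kkP n a b ℓ) * 2 ^ (PP + 2) := Nat.mul_lt_mul_of_lt_of_le hkklt le_rfl h0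
    _ = 2 ^ (Nat.size (kkP n a b ℓ) + (PP + 2)) := (pow_add 2 _ _).symm
    _ ≤ 2 ^ (4 * Nat.size ℓ + 3 * sP n a b + 12 * PP + 82) := Nat.pow_le_pow_right (by norm_num) (by omega)

/-- `size N ≤ 6·size ℓ + 7s + 17P + 128`. [folklore] -/
theorem size_NP_le : Nat.size (NP n a b ℓ) ≤ 6 * Nat.size ℓ + 7 * sP n a b + 17 * PP + 128 := by
  have hβ := size_βP_le n a b ℓ
  have hβlt : βP n a b ℓ < 2 ^ Nat.size (βP n a b ℓ) := Nat.lt_size_self _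
  have hn : n < 2 ^ sP n a b := lt_of_le_of_lt (by omega) (Nat.lt_size_self (n + a + b + 2))
  rw [Nat.size_le]
  have e : NP n a b ℓ = 2 ^ (τP ℓ + 1 + κP n a b ℓ) * (n + βP n a b ℓ) := by
    rw [NP, TP, kP, pow_add, pow_succ]; ring
  rw [e]
  have hsum : n + βP n a b ℓ < 2 ^ (sP n a b + Nat.size (βP n a b ℓ) + 1) := by
    have := two_pow_add_two_pow_le (sP n a b) (Nat.size (βP n a b ℓ)); omega
  have hexp : τP ℓ + 1 + κP n a b ℓ + (sP n a b + Nat.size (βP n a b ℓ) + 1) ≤ 6 * Nat.size ℓ + 7 * sP n a b + 17 * PP + 128 := by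
    unfold τP κP; omega
  have hlt : 2 ^ (τP ℓ + 1 + κP n a b ℓ) * (n + βP n a b ℓ) < 2 ^ (τP ℓ + 1 + κP n a b ℓ) * 2 ^ (sP n a b + Nat.size (βP n a b ℓ) + 1) :=
    Nat.mul_lt_mul_of_pos_left hsum (Nat.two_pow_pos _)
  rw [← pow_add] at hlt
  exact lt_of_lt_of_le hlt (Nat.pow_le_pow_right (by norm_num) hexp)

/-- `te ≤ 6·size ℓ + 7s + 17P + 129`. [folklore] -/
theorem teP_le : teP n a b ℓ ≤ 6 * Nat.size ℓ + 7 * sP n a b + 17 * PP + 129 := by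
  have hN := size_NP_le n a b ℓ
  have hc2 : Nat.clog 2 (NP n a b ℓ) ≤ Nat.size (NP n a b ℓ) := Nat.clog_le_of_le_pow (Nat.lt_size_self _).le
  have hcp : Nat.clog 𝔭 (NP n a b ℓ) ≤ Nat.clog 2 (NP n a b ℓ) := Nat.clog_anti_left (by norm_num) P.prime.two_le
  rw [teP, prmTe]
  exact max_le (by omega) (by omega)

/-- `size (p^te) ≤ P · te`. [folklore] -/
theorem size_QP_le : Nat.size (𝔭 ^ teP n a b ℓ) ≤ PP * teP n a b ℓ := by
  rw [Nat.size_le, pow_mul]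
  exact Nat.pow_lt_pow_left p_lt_two_pow_PP (teP_ne_zero n a b ℓ)

omit P in
/-- `size (n^{k₀} + k₀ + 1) ≤ s k₀ + k₀ + 2`. [folklore] -/
theorem size_sc_le : Nat.size (n ^ k₀ + k₀ + 1) ≤ sP n a b * k₀ + k₀ + 2 := by
  have hn : n < 2 ^ sP n a b := lt_of_le_of_lt (by omega) (Nat.lt_size_self (n + a + b + 2))
  rw [Nat.size_le]
  have h1 : n ^ k₀ ≤ 2 ^ (sP n a b * k₀) := by rw [pow_mul]; exact Nat.pow_le_pow_left hn.le _
  have h2 : k₀ + 1 ≤ 2 ^ k₀ := Nat.lt_two_pow_self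
  have h3 := two_pow_add_two_pow_le (sP n a b * k₀) k₀
  calc n ^ k₀ + k₀ + 1 ≤ 2 ^ (sP n a b * k₀) + 2 ^ k₀ := by omega
    _ < 2 ^ (sP n a b * k₀ + k₀ + 2) := by
        have : 2 ^ (sP n a b * k₀ + k₀ + 1) < 2 ^ (sP n a b * k₀ + k₀ + 2) := Nat.pow_lt_pow_right (by norm_num) (by omega)
        omega

/-- **`ℓ' ≤ A + B · size ℓ`.** [folklore] -/
theorem ellLvl_le : ellLvl k₀ n a b ℓ ≤ ellA k₀ n a b + ellB * Nat.size ℓ := by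
  have h1 : Nat.size (TP ℓ) = τP ℓ + 1 := by rw [TP, Nat.size_pow]
  have h2 : Nat.size (𝔭 + 1) ≤ PP + 1 := by
    rw [Nat.size_le, pow_succ]; have := p_lt_two_pow_PP; omega
  have h3 : Nat.size (kP n a b ℓ) = κP n a b ℓ + 1 := by rw [kP, Nat.size_pow]
  have h4 := size_βP_le n a b ℓ
  have h5 : Nat.size (n + 1) ≤ sP n a b := by
    rw [Nat.size_le]; exact lt_of_le_of_lt (by omega) (Nat.lt_size_self (n + a + b + 2))
  have h6 := size_sc_le k₀ n a b
  have h7 := size_QP_le n a b ℓ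
  have h8 : Nat.size (teP n a b ℓ) ≤ teP n a b ℓ := (Nat.size_le).2 Nat.lt_two_pow_self
  have h9 := teP_le n a b ℓ
  have h10 : Nat.size (ℓ + 1) ≤ Nat.size ℓ + 1 := by
    rw [Nat.size_le, pow_succ]; have := Nat.lt_size_self ℓ; omega
  have h7' : Nat.size (𝔭 ^ teP n a b ℓ) ≤ PP * (6 * Nat.size ℓ + 7 * sP n a b + 17 * PP + 129) := h7.trans (Nat.mul_le_mul_left _ h9)
  rw [ellLvl, ellP, h1, h3, show n ^ k₀ + k₀ + 1 = n ^ k₀ + k₀ + 1 from rfl]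
  unfold ellA ellB τP κP
  generalize Nat.size ℓ = L at *
  generalize sP n a b = S at *
  generalize PP = Q at *
  generalize Nat.size (βP n a b ℓ) = x4 at *
  generalize Nat.size (n ^ k₀ + k₀ + 1) = x6 at *
  generalize Nat.size (𝔭 ^ teP n a b ℓ) = x7 at *
  generalize Nat.size (teP n a b ℓ) = x8 at *
  generalize teP n a b ℓ = x9 at *
  generalize Nat.size (𝔭 + 1) = x2 at *
  generalize Nat.size (n + 1) = x5 at *
  generalize Nat.size (ℓ + 1) = x10 at *
  nlinarith

end EllBound

/-! ### The explicit good level -/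

section GoodLevel

variable [P : PrimeP] (d k₀ n a b : ℕ)

/-- `D' = 2(d + 11)`. [folklore] -/
def DdP (d : ℕ) : ℕ := 2 * (d + 11)

/-- `C₀ = A + B`. [folklore] -/
def C0P : ℕ := ellA k₀ n a b + ellB

/-- `G = 64 (2^P C₀)^{D'}`. [folklore] -/
def GP : ℕ := 64 * (2 ^ PP * C0P k₀ n a b) ^ DdP d

/-- `j = size G + 8 D' + 4`. [folklore] -/
def jP : ℕ := Nat.size (GP d k₀ n a b) + 8 * DdP d + 4

/-- `m = 4 D' j`. [folklore] -/
def mP : ℕ := 4 * DdP d * jP d k₀ n a b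

/-- **The good level** `ℓ_g = 2^m`. [cite: CarmosinoImpagliazzoKabanetsKolokolova2016, Thm. 5.1 (proof: choice of `ℓ = poly`)] -/
def goodLvlP : ℕ := 2 ^ mP d k₀ n a b

omit P in
/-- `oddFloor (2^m) = 2^m - 1` for `m ≥ 1`. [folklore] -/
theorem oddFloor_two_pow {m : ℕ} (hm : 1 ≤ m) : oddFloor (2 ^ m) = 2 ^ m - 1 := by
  rw [oddFloor, if_neg]
  rw [Nat.not_odd_iff_even]
  exact (Nat.even_pow' (by omega)).2 (by decide)

omit P in
/-- `1 ≤ D'`. [folklore] -/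
theorem one_le_DdP : 1 ≤ DdP d := by unfold DdP; omega

/-- `1 ≤ m`. [folklore] -/
theorem one_le_mP : 1 ≤ mP d k₀ n a b := by
  unfold mP jP; have := one_le_DdP d; nlinarith

/-- `(m + 1)^{D'} ≤ 2^{2 D' j}`. [folklore] -/
theorem succ_mP_pow_le : (mP d k₀ n a b + 1) ^ DdP d ≤ 2 ^ (2 * DdP d * jP d k₀ n a b) := by
  have hD := one_le_DdP d
  obtain ⟨j, hj⟩ : ∃ j, jP d k₀ n a b = j := ⟨_, rfl⟩
  obtain ⟨D, hDD⟩ : ∃ D, DdP d = D := ⟨_, rfl⟩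
  have hj12 : 8 * D + 4 ≤ j := by rw [← hj, ← hDD]; unfold jP; omega
  rw [hDD] at hD
  have hm : mP d k₀ n a b = 4 * D * j := by rw [mP, hj, hDD]
  rw [hj, hm, hDD]
  -- `m + 1 = 4 D' j + 1 ≤ (4D' + 1) j ≤ 2^j · 2^j`
  have h1 : 4 * D * j + 1 ≤ 2 ^ j * 2 ^ j := by
    have hjpow : j + 1 ≤ 2 ^ j := Nat.lt_two_pow_self
    have hDpow : 4 * D + 1 ≤ 2 ^ j := le_trans (by omega) (le_trans (Nat.lt_two_pow_self (n := 8 * D + 4)).le (Nat.pow_le_pow_right (by norm_num) hj12))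
    calc 4 * D * j + 1 ≤ (4 * D + 1) * j := by nlinarith
      _ ≤ 2 ^ j * 2 ^ j := Nat.mul_le_mul hDpow (by omega)
  have e : 2 ^ j * 2 ^ j = 2 ^ (2 * j) := by rw [← pow_add]; exact congrArg (fun x => 2 ^ x) (by ring)
  calc (4 * D * j + 1) ^ D ≤ (2 ^ j * 2 ^ j) ^ D := Nat.pow_le_pow_left h1 _
    _ = 2 ^ (2 * D * j) := by rw [e, ← pow_mul]; exact congrArg (fun x => 2 ^ x) (by ring)

/-- **The degree condition at the good level**: `64((p-1)ℓ')^{D'} ≤ oddFloor ℓ_g`.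
[cite: CarmosinoImpagliazzoKabanetsKolokolova2016, Thm. 5.1 (proof)] -/
theorem hdeg_goodLvlP : 64 * ((𝔭 - 1) * ellLvl k₀ n a b (goodLvlP d k₀ n a b)) ^ (2 * (d + 11)) ≤ oddFloor (goodLvlP d k₀ n a b) := by
  have hD := one_le_DdP d
  have hm := one_le_mP d k₀ n a b
  have hsucc := succ_mP_pow_le d k₀ n a b
  rw [goodLvlP, oddFloor_two_pow hm, show 2 * (d + 11) = DdP d from rfl]
  obtain ⟨j, hj⟩ : ∃ j, jP d k₀ n a b = j := ⟨_, rfl⟩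
  obtain ⟨m, hmdef⟩ : ∃ m, mP d k₀ n a b = m := ⟨_, rfl⟩
  have hm4j : m = 4 * DdP d * j := by rw [← hmdef, mP, hj]
  rw [hj, hmdef] at hsucc
  rw [hmdef] at hm ⊢
  -- `ℓ' ≤ C₀ (m + 1)`
  have hell : ellLvl k₀ n a b (2 ^ m) ≤ C0P k₀ n a b * (m + 1) := by
    have h := ellLvl_le k₀ n a b (2 ^ m)
    rw [Nat.size_pow] at h
    unfold C0P; nlinarith [Nat.zero_le (ellA k₀ n a b), Nat.zero_le ellB]
  -- `(p - 1) ℓ' ≤ 2^P C₀ (m+1)`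
  have hp1 : 𝔭 - 1 ≤ 2 ^ PP := by have := p_lt_two_pow_PP; omega
  have hbase : (𝔭 - 1) * ellLvl k₀ n a b (2 ^ m) ≤ 2 ^ PP * C0P k₀ n a b * (m + 1) := by
    rw [Nat.mul_assoc]; exact Nat.mul_le_mul hp1 hell
  -- `64 ((p-1)ℓ')^{D'} ≤ G (m+1)^{D'} ≤ G · 2^{2D'j}`
  have hG : 64 * ((𝔭 - 1) * ellLvl k₀ n a b (2 ^ m)) ^ DdP d ≤ GP d k₀ n a b * 2 ^ (2 * DdP d * j) := by
    calc 64 * ((𝔭 - 1) * ellLvl k₀ n a b (2 ^ m)) ^ DdP d ≤ 64 * (2 ^ PP * C0P k₀ n a b * (m + 1)) ^ DdP d :=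
          Nat.mul_le_mul_left 64 (Nat.pow_le_pow_left hbase _)
      _ = GP d k₀ n a b * (m + 1) ^ DdP d := by rw [GP, mul_pow]; ring
      _ ≤ GP d k₀ n a b * 2 ^ (2 * DdP d * j) := Nat.mul_le_mul_left _ hsucc
  -- `G + 1 ≤ 2^{size G} ≤ 2^{2D'j}`
  have hG1 : GP d k₀ n a b + 1 ≤ 2 ^ (2 * DdP d * j) := by
    have h1 : GP d k₀ n a b < 2 ^ Nat.size (GP d k₀ n a b) := Nat.lt_size_self _
    have h2 : Nat.size (GP d k₀ n a b) ≤ 2 * DdP d * j := by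
      have : Nat.size (GP d k₀ n a b) ≤ j := by rw [← hj]; unfold jP; omega
      nlinarith
    exact h1.trans_le (Nat.pow_le_pow_right (by norm_num) h2)
  have hm4 : 2 ^ m = 2 ^ (2 * DdP d * j) * 2 ^ (2 * DdP d * j) := by rw [← pow_add, hm4j]; exact congrArg (fun x => 2 ^ x) (by ring)
  have hY : 1 ≤ 2 ^ (2 * DdP d * j) := Nat.one_le_two_pow
  refine le_trans hG ?_
  -- `G Y ≤ 2^m - 1` since `(G + 1) Y ≤ 2^m`
  have : (GP d k₀ n a b + 1) * 2 ^ (2 * DdP d * j) ≤ 2 ^ m := by rw [hm4]; exact Nat.mul_le_mul_right _ hG1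
  rw [Nat.add_mul, one_mul] at this
  omega

/-- **The size condition at every level `ℓ ≥ 1`**: `16 · ampPSize < p^{ℓ'}`. [folklore] -/
theorem hsize_ellLvl (ℓ : ℕ) :
    16 * ampPSize n (kP n a b ℓ) (βP n a b ℓ) (TP ℓ) ℓ (teP n a b ℓ) 𝔭 (n ^ k₀ + k₀) < 𝔭 ^ ellLvl k₀ n a b ℓ := by
  have h := sixteen_ampPSize_lt (n := n) (ℓ := ℓ) (sc := n ^ k₀ + k₀) (kP_pos n a b ℓ) (show 1 ≤ βP n a b ℓ by unfold βP; omega) (TP_pos ℓ)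
    (Nat.one_le_iff_ne_zero.2 (teP_ne_zero n a b ℓ)) P.prime.two_le
  rw [ellLvl]
  exact h.trans_le (Nat.pow_le_pow_left P.prime.two_le _)

/-- **The good level is good.** [cite: CarmosinoImpagliazzoKabanetsKolokolova2016, Thm. 5.1 (proof)] -/
theorem goodLvlP_good : GoodLevelP d k₀ n a b (goodLvlP d k₀ n a b) := by
  refine ⟨Nat.one_le_two_pow, ellLvl k₀ n a b (goodLvlP d k₀ n a b), by unfold ellLvl ellP; omega, hdeg_goodLvlP d k₀ n a b, ?_⟩
  exact hsize_ellLvl k₀ n a b _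

end GoodLevel

end Modp

end Literature.Computability.Learning


/-!
## Part — The `AC⁰[p]` learner: quasi-polynomial budgets

Analysis for the named fact `Literature.Computability.Learning.cikk_learn_AC0Mod` (CIKK 2016,
Cor. 5.4): the coin length of the learner at the good level and its number of rounds are
quasi-polynomial in `n + a + b`:

* `lvlBlockLenP_le_pow`: `lvlBlockLenP n a b ℓ ≤ 2^{bE(ℓ)}` with `bE` explicit and monotone in `ℓ`
  (`bEf_mono`), hence `coinLenP n a b ℓg ≤ 2^{bE(ℓg) + ℓg}` (`coinLenP_le_pow`);
* `mP_le`, `goodLvlP_le`: the good level is `≤ 2^{c₁} · (2(s+1))^{4D'²}`;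
* `isQuasiPolyBudget_of_le`: a budget that vanishes when `a = 0 ∨ b = 0` and is
  `≤ 2^{K (s+1)^E}` otherwise is quasi-polynomial; the budgets `cikkCoinsP`, `cikkRoundsP`.

## References

* M. Carmosino, R. Impagliazzo, V. Kabanets, A. Kolokolova, *Learning algorithms from natural
  proofs*, CCC 2016, Thm. 5.1, Cor. 5.4 [CarmosinoImpagliazzoKabanetsKolokolova2016].
-/

namespace Literature.Computability.Learning

namespace Modp

open Literature.Computability.Complexity Literature.Computability.MetaComplexity Literature.Computability.Cryptography _root_.Computability Finset

variable [P : PrimeP]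

/-! ### Power-of-two bounds on the level quantities -/

section Level

variable (n a b ℓ : ℕ)

omit P in
/-- Eight terms each `≤ 2^e` sum to `≤ 2^{e+3}`. [folklore] -/
theorem sum8_le_pow {e x₁ x₂ x₃ x₄ x₅ x₆ x₇ x₈ : ℕ} (h₁ : x₁ ≤ 2 ^ e) (h₂ : x₂ ≤ 2 ^ e) (h₃ : x₃ ≤ 2 ^ e) (h₄ : x₄ ≤ 2 ^ e)
    (h₅ : x₅ ≤ 2 ^ e) (h₆ : x₆ ≤ 2 ^ e) (h₇ : x₇ ≤ 2 ^ e) (h₈ : x₈ ≤ 2 ^ e) :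
    x₁ + x₂ + x₃ + x₄ + x₅ + x₆ + x₇ + x₈ ≤ 2 ^ (e + 3) := by rw [pow_add]; omega

omit P in
/-- `2^x ≤ 2^y` from `x ≤ y`. [folklore] -/
theorem pow_mono {x y : ℕ} (h : x ≤ y) : 2 ^ x ≤ 2 ^ y := Nat.pow_le_pow_right (by norm_num) h

/-- The exponent of `t`: `t ≤ 2^{y_t}`, `y_t = κ + 3ℓ + 2τ + 4P + s + 60 + kk P`. [folklore] -/
def ytP : ℕ := κP n a b ℓ + 3 * ℓ + 2 * τP ℓ + 4 * PP + sP n a b + 60 + kkP n a b ℓ * PP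

/-- `t ≤ 2^{y_t}`. [folklore] -/
theorem tP_le_pow : tP n a b ℓ ≤ 2 ^ ytP n a b ℓ := by
  rw [tP, KKP, ytP, pow_add 2 _ (kkP n a b ℓ * PP)]
  refine Nat.mul_le_mul_left _ ?_
  rw [mul_comm, pow_mul]; exact Nat.pow_le_pow_left (p_lt_two_pow_PP).le _

/-- The bound `y_T = 6·size ℓ + 7s + 17P + 129 ≥ te`. [folklore] -/
def yTeP : ℕ := 6 * Nat.size ℓ + 7 * sP n a b + 17 * PP + 129

/-- The exponent `Z` of the free bits: `Z = y_t + κ + s + 2 P y_T + ℓ + size ℓ + τ + 8`. [folklore] -/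
def ZP : ℕ := ytP n a b ℓ + κP n a b ℓ + sP n a b + 2 * (PP * yTeP n a b ℓ) + ℓ + Nat.size ℓ + τP ℓ + 8

omit P in
/-- `n < 2^s`. [folklore] -/
theorem n_lt_two_pow_sP : n < 2 ^ sP n a b := lt_of_le_of_lt (by omega) (Nat.lt_size_self (n + a + b + 2))

/-- **The free bits of a run are `≤ 2^Z`.** [folklore] -/
theorem nFree_le_pow : nFree (teP n a b ℓ) ℓ n (κP n a b ℓ) (τP ℓ) (tP n a b ℓ) ≤ 2 ^ ZP n a b ℓ := by
  have hn := (n_lt_two_pow_sP n a b).le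
  have ht := tP_le_pow n a b ℓ
  have hte := teP_le n a b ℓ
  have hkn : 2 ^ κP n a b ℓ * n ≤ 2 ^ (κP n a b ℓ + sP n a b) := by rw [pow_add]; exact Nat.mul_le_mul_left _ hn
  have hκ : κP n a b ℓ ≤ 2 ^ (κP n a b ℓ + sP n a b) := (Nat.lt_two_pow_self).le.trans (pow_mono (by omega))
  have hQ : 𝔭 ^ teP n a b ℓ * 𝔭 ^ teP n a b ℓ ≤ 2 ^ (2 * (PP * yTeP n a b ℓ)) := by
    have h1 : 𝔭 ^ teP n a b ℓ ≤ 2 ^ (PP * yTeP n a b ℓ) := by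
      calc 𝔭 ^ teP n a b ℓ ≤ (2 ^ PP) ^ teP n a b ℓ := Nat.pow_le_pow_left (p_lt_two_pow_PP).le _
        _ = 2 ^ (PP * teP n a b ℓ) := by rw [← pow_mul]
        _ ≤ 2 ^ (PP * yTeP n a b ℓ) := pow_mono (Nat.mul_le_mul_left _ (by rw [yTeP]; exact hte))
    rw [two_mul, pow_add]; exact Nat.mul_le_mul h1 h1
  set e := ZP n a b ℓ - 3 with he
  have hZ : ZP n a b ℓ = e + 3 := by rw [he, ZP]; omega
  have heZ : ytP n a b ℓ + κP n a b ℓ + sP n a b + 2 * (PP * yTeP n a b ℓ) + ℓ + Nat.size ℓ + τP ℓ + 5 ≤ e := by rw [he, ZP]; omega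
  rw [nFree, hZ]
  refine sum8_le_pow ?_ ?_ ?_ ?_ ?_ ?_ ?_ ?_
  · exact (le_two_pow_size ℓ).trans (pow_mono (by omega))
  · exact hQ.trans (pow_mono (by omega))
  · exact pow_mono (by omega)
  · exact (Nat.lt_two_pow_self (n := τP ℓ + 1)).le.trans (pow_mono (by omega))
  · calc 2 ^ τP ℓ * 2 * (2 ^ κP n a b ℓ * n) ≤ 2 ^ τP ℓ * 2 * 2 ^ (κP n a b ℓ + sP n a b) := Nat.mul_le_mul_left _ hkn
      _ = 2 ^ (τP ℓ + 1 + (κP n a b ℓ + sP n a b)) := by rw [pow_add 2 (τP ℓ + 1), pow_succ]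
      _ ≤ 2 ^ e := pow_mono (by omega)
  · exact (pow_mono (by omega) : 2 ^ κP n a b ℓ ≤ 2 ^ e)
  · exact hkn.trans (pow_mono (by omega))
  · calc tP n a b ℓ * (κP n a b ℓ + 2 ^ κP n a b ℓ * n) ≤ 2 ^ ytP n a b ℓ * (2 ^ (κP n a b ℓ + sP n a b) + 2 ^ (κP n a b ℓ + sP n a b)) :=
          Nat.mul_le_mul ht (add_le_add hκ hkn)
      _ = 2 ^ (ytP n a b ℓ + (κP n a b ℓ + sP n a b) + 1) := by rw [← two_mul, pow_add, pow_add, pow_one]; ring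
      _ ≤ 2 ^ e := pow_mono (by omega)

/-- **The run length is `≤ 2^{Z + 2β + 1}`.** [folklore] -/
theorem lvlRunLenP_le_pow : lvlRunLenP n a b ℓ ≤ 2 ^ (ZP n a b ℓ + 2 * βP n a b ℓ + 1) := by
  have hfree := nFree_le_pow n a b ℓ
  have hnb : nBlocks (κP n a b ℓ) (τP ℓ) (kkP n a b ℓ) (tP n a b ℓ) ≤ 2 ^ βP n a b ℓ := by
    have h := two_p_nBlocks_le n a b ℓ
    have hp : 1 ≤ 2 * 𝔭 := by have := P.prime.pos; omega
    exact le_trans (Nat.le_mul_of_pos_left _ hp) h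
  have hβ : βP n a b ℓ * nBlocks (κP n a b ℓ) (τP ℓ) (kkP n a b ℓ) (tP n a b ℓ) ≤ 2 ^ (2 * βP n a b ℓ) := by
    rw [two_mul, pow_add]; exact Nat.mul_le_mul (le_two_pow_size _ |>.trans (pow_mono ((Nat.size_le).2 Nat.lt_two_pow_self))) hnb
  have e : lvlRunLenP n a b ℓ = nFree (teP n a b ℓ) ℓ n (κP n a b ℓ) (τP ℓ) (tP n a b ℓ) + βP n a b ℓ * nBlocks (κP n a b ℓ) (τP ℓ) (kkP n a b ℓ) (tP n a b ℓ) := by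
    rw [lvlRunLenP, kP, TP, QP]; exact runLenP_eq_free_add _ _ _ _ _ _ _ _
  rw [e]
  calc _ ≤ 2 ^ ZP n a b ℓ + 2 ^ (2 * βP n a b ℓ) := add_le_add hfree hβ
    _ ≤ 2 ^ (ZP n a b ℓ + 2 * βP n a b ℓ + 1) := two_pow_add_two_pow_le _ _

/-- **The queries of a run are `≤ 2^{2ℓ + τ + κ + 3}`.** [folklore] -/
theorem nQRunP_le_pow : nQRunP n a b ℓ ≤ 2 ^ (2 * ℓ + τP ℓ + κP n a b ℓ + 3) := by
  rw [nQRunP, TP, kP]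
  have h1 : 2 ^ ℓ * 2 ^ ℓ * (2 ^ τP ℓ * 2 * 2 ^ κP n a b ℓ) = 2 ^ (2 * ℓ + τP ℓ + κP n a b ℓ + 1) := by
    rw [show 2 * ℓ + τP ℓ + κP n a b ℓ + 1 = ℓ + ℓ + τP ℓ + 1 + κP n a b ℓ by ring, pow_add, pow_add, pow_add, pow_add, pow_one]; ring
  have h2 : 2 ^ τP ℓ * 2 * 2 ^ κP n a b ℓ ≤ 2 ^ (2 * ℓ + τP ℓ + κP n a b ℓ + 1) := by
    rw [← pow_succ, ← pow_add]; exact pow_mono (by omega)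
  have h3 : 2 ^ κP n a b ℓ ≤ 2 ^ (2 * ℓ + τP ℓ + κP n a b ℓ + 1) := pow_mono (by omega)
  have h4 : 2 ^ (2 * ℓ + τP ℓ + κP n a b ℓ + 3) = 4 * 2 ^ (2 * ℓ + τP ℓ + κP n a b ℓ + 1) := by
    rw [show 2 * ℓ + τP ℓ + κP n a b ℓ + 3 = (2 * ℓ + τP ℓ + κP n a b ℓ + 1) + 2 by ring, pow_add]; ring
  rw [h1, h4]; omega

/-- The exponent of a level block (as a function of `ℓ` and `λ = size ℓ`). [folklore] -/
def bEf (n a b ℓ lam : ℕ) : ℕ :=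
  let κ := 3 * sP n a b + lam + 4 * PP + 40
  let τ := lam + PP + 4
  let kk := κ + 2 * ℓ + 2 * τ + 5 * PP + 30
  let β := 2 * κ + 3 * ℓ + 3 * τ + 5 * PP + sP n a b + kk * PP + kk + 70
  let rE := 4 * ℓ + 3 * τ + 8 * PP + 2 * kk * PP + sP n a b + 80
  let yt := κ + 3 * ℓ + 2 * τ + 4 * PP + sP n a b + 60 + kk * PP
  let yTe := 6 * lam + 7 * sP n a b + 17 * PP + 129
  let Z := yt + κ + sP n a b + 2 * (PP * yTe) + ℓ + lam + τ + 8
  (rE + (Z + 2 * β + 2 * ℓ + τ + κ + 5)) + (rE + 5 * sP n a b + 14) + 1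

/-- The exponent of a level block. [folklore] -/
def bE : ℕ := bEf n a b ℓ (Nat.size ℓ)

/-- The pieces of `bE` are the level parameters. [folklore] -/
theorem bE_eq : bE n a b ℓ = (repsExpP n a b ℓ + (ZP n a b ℓ + 2 * βP n a b ℓ + 2 * ℓ + τP ℓ + κP n a b ℓ + 5)) +
    (repsExpP n a b ℓ + 5 * sP n a b + 14) + 1 := by
  rfl

/-- **A level block is `≤ 2^{bE}`.** [folklore] -/
theorem lvlBlockLenP_le_pow : lvlBlockLenP n a b ℓ ≤ 2 ^ bE n a b ℓ := by
  have hrun := lvlRunLenP_le_pow n a b ℓ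
  have hq := nQRunP_le_pow n a b ℓ
  have hn := (n_lt_two_pow_sP n a b).le
  have hslot : lvlSlotP n a b ℓ ≤ 2 ^ (ZP n a b ℓ + 2 * βP n a b ℓ + 2 * ℓ + τP ℓ + κP n a b ℓ + 5) := by
    rw [lvlSlotP]
    calc lvlRunLenP n a b ℓ + nQRunP n a b ℓ ≤ 2 ^ (ZP n a b ℓ + 2 * βP n a b ℓ + 1) + 2 ^ (2 * ℓ + τP ℓ + κP n a b ℓ + 3) := add_le_add hrun hq
      _ ≤ 2 ^ (ZP n a b ℓ + 2 * βP n a b ℓ + 1 + (2 * ℓ + τP ℓ + κP n a b ℓ + 3) + 1) := two_pow_add_two_pow_le _ _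
      _ = 2 ^ (ZP n a b ℓ + 2 * βP n a b ℓ + 2 * ℓ + τP ℓ + κP n a b ℓ + 5) := congrArg (fun x => 2 ^ x) (by ring)
  have h1 : RepsP n a b ℓ * lvlSlotP n a b ℓ ≤ 2 ^ (repsExpP n a b ℓ + (ZP n a b ℓ + 2 * βP n a b ℓ + 2 * ℓ + τP ℓ + κP n a b ℓ + 5)) := by
    rw [RepsP, pow_add]; exact Nat.mul_le_mul_left _ hslot
  have h2 : MP n a b ℓ * n ≤ 2 ^ (repsExpP n a b ℓ + 5 * sP n a b + 14) := by
    rw [MP]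
    have h4 : (4 : ℕ) ^ sP n a b = 2 ^ (2 * sP n a b) := by rw [pow_mul]; norm_num
    have hx : repsExpP n a b ℓ + 2 * sP n a b + 8 ≤ 2 ^ (repsExpP n a b ℓ + 2 * sP n a b + 8) := (Nat.lt_two_pow_self).le
    calc 64 * 4 ^ sP n a b * (repsExpP n a b ℓ + 2 * sP n a b + 8) * n
        ≤ 64 * 4 ^ sP n a b * 2 ^ (repsExpP n a b ℓ + 2 * sP n a b + 8) * 2 ^ sP n a b := Nat.mul_le_mul (Nat.mul_le_mul_left _ hx) hn
      _ = 2 ^ (repsExpP n a b ℓ + 5 * sP n a b + 14) := by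
          rw [h4, show (64 : ℕ) = 2 ^ 6 by norm_num, ← pow_add, ← pow_add, ← pow_add]; exact congrArg (fun x => 2 ^ x) (by ring)
  rw [lvlBlockLenP, bE_eq]
  calc RepsP n a b ℓ * lvlSlotP n a b ℓ + MP n a b ℓ * n ≤ _ := add_le_add h1 h2
    _ ≤ _ := two_pow_add_two_pow_le _ _

omit P in
/-- `bEf` is monotone in both arguments. [folklore] -/
theorem bEf_mono {ℓ ℓ' lam lam' : ℕ} (hℓ : ℓ ≤ ℓ') (hlam : lam ≤ lam') [PrimeP] : bEf n a b ℓ lam ≤ bEf n a b ℓ' lam' := by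
  unfold bEf
  simp only []
  gcongr

/-- `bE` is monotone. [folklore] -/
theorem bE_mono {ℓ ℓ' : ℕ} (h : ℓ ≤ ℓ') : bE n a b ℓ ≤ bE n a b ℓ' := bEf_mono n a b h (Nat.size_le_size h)

/-- **The coin length is `≤ 2^{bE(ℓ_g) + ℓ_g}`.** [folklore] -/
theorem coinLenP_le_pow (ℓg : ℕ) : coinLenP n a b ℓg ≤ 2 ^ (bE n a b ℓg + ℓg) := by
  rw [coinLenP, lvlCoffP]
  calc ∑ ℓ' ∈ Finset.range (ℓg + 1), lvlBlockLenP n a b ℓ' ≤ ∑ _ℓ' ∈ Finset.range (ℓg + 1), 2 ^ bE n a b ℓg :=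
        Finset.sum_le_sum fun ℓ' hℓ' => (lvlBlockLenP_le_pow n a b ℓ').trans (pow_mono (bE_mono n a b (by rw [Finset.mem_range] at hℓ'; omega)))
    _ = (ℓg + 1) * 2 ^ bE n a b ℓg := by rw [Finset.sum_const, Finset.card_range, smul_eq_mul]
    _ ≤ 2 ^ ℓg * 2 ^ bE n a b ℓg := Nat.mul_le_mul_right _ (Nat.lt_two_pow_self (n := ℓg))
    _ = 2 ^ (bE n a b ℓg + ℓg) := by rw [← pow_add, add_comm]

end Level

/-! ### The size of the exponents -/

section Sizes

variable (d k₀ n a b : ℕ)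

omit P in
/-- **`bEf ≤ 256 (ℓ + λ + s + P + 40)(P + 1)`.** [folklore] -/
theorem bEf_le (ℓ lam : ℕ) [PrimeP] : bEf n a b ℓ lam ≤ 256 * (ℓ + lam + sP n a b + PP + 40) * (PP + 1) := by
  unfold bEf
  simp only []
  generalize sP n a b = S
  generalize PP = Q
  nlinarith [Nat.zero_le (ℓ * Q), Nat.zero_le (lam * Q), Nat.zero_le (S * Q), Nat.zero_le (Q * Q), Nat.zero_le ℓ, Nat.zero_le lam,
    Nat.zero_le S, Nat.zero_le Q]

/-- **`bE(ℓ) + ℓ ≤ 2^{10} (ℓ+1)(s+1)(P+41)(P+1)`.** [folklore] -/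
theorem bE_add_le (ℓ : ℕ) : bE n a b ℓ + ℓ ≤ 2 ^ 10 * ((ℓ + 1) * (sP n a b + 1) * (PP + 41) * (PP + 1)) := by
  have h := bEf_le n a b ℓ (Nat.size ℓ)
  rw [← bE] at h
  have hlam : Nat.size ℓ ≤ ℓ + 1 := by rw [Nat.size_le, pow_succ]; have := Nat.lt_two_pow_self (n := ℓ); omega
  have hW : ℓ + Nat.size ℓ + sP n a b + PP + 40 ≤ 2 * ((ℓ + 1) * (sP n a b + 1) * (PP + 41)) := by
    obtain ⟨A, hA⟩ : ∃ A, (ℓ + 1) * (sP n a b + 1) = A := ⟨_, rfl⟩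
    have hA1 : ℓ + 1 + sP n a b ≤ A := by rw [← hA]; nlinarith
    have hA2 : PP + 41 * A ≤ A * (PP + 41) := by nlinarith
    rw [hA]; omega
  have hW2 : ℓ ≤ (ℓ + 1) * (sP n a b + 1) * (PP + 41) * (PP + 1) := by
    calc ℓ ≤ ℓ + 1 := by omega
      _ = (ℓ + 1) * 1 * 1 * 1 := by ring
      _ ≤ (ℓ + 1) * (sP n a b + 1) * (PP + 41) * (PP + 1) := Nat.mul_le_mul (Nat.mul_le_mul (Nat.mul_le_mul_left _ (by omega)) (by omega)) (by omega)
  calc bE n a b ℓ + ℓ ≤ 256 * (ℓ + Nat.size ℓ + sP n a b + PP + 40) * (PP + 1) + ℓ := by omega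
    _ ≤ 256 * (2 * ((ℓ + 1) * (sP n a b + 1) * (PP + 41))) * (PP + 1) + (ℓ + 1) * (sP n a b + 1) * (PP + 41) * (PP + 1) :=
        add_le_add (Nat.mul_le_mul_right _ (Nat.mul_le_mul_left _ hW)) hW2
    _ ≤ 2 ^ 10 * ((ℓ + 1) * (sP n a b + 1) * (PP + 41) * (PP + 1)) := by
        have : 256 * (2 * ((ℓ + 1) * (sP n a b + 1) * (PP + 41))) * (PP + 1) = 512 * ((ℓ + 1) * (sP n a b + 1) * (PP + 41) * (PP + 1)) := by ring
        rw [this]; norm_num; omega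

/-- `C₀ ≤ 345 (s+1)(k₀+1)(P+1)²`. [folklore] -/
theorem C0P_le : C0P k₀ n a b ≤ 345 * ((sP n a b + 1) * (k₀ + 1) * (PP + 1) ^ 2) := by
  unfold C0P ellA ellB
  generalize sP n a b = S
  generalize PP = Q
  nlinarith [Nat.zero_le (S * k₀), Nat.zero_le (S * Q), Nat.zero_le (Q * Q), Nat.zero_le (k₀ * Q), Nat.zero_le S, Nat.zero_le Q, Nat.zero_le k₀,
    Nat.zero_le (S * k₀ * Q), Nat.zero_le (S * Q * Q), Nat.zero_le (k₀ * Q * Q), Nat.zero_le (S * k₀ * Q * Q)]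

/-- `size C₀ ≤ 9 + size(s+1) + size(k₀+1) + 2·size(P+1)`. [folklore] -/
theorem size_C0P_le : Nat.size (C0P k₀ n a b) ≤ 9 + Nat.size (sP n a b + 1) + Nat.size (k₀ + 1) + 2 * Nat.size (PP + 1) := by
  rw [Nat.size_le]
  have h := C0P_le k₀ n a b
  have h1 := Nat.lt_size_self (sP n a b + 1)
  have h2 := Nat.lt_size_self (k₀ + 1)
  have h3 := Nat.lt_size_self (PP + 1)
  have hprod : (sP n a b + 1) * (k₀ + 1) * (PP + 1) ^ 2 < 2 ^ (Nat.size (sP n a b + 1) + Nat.size (k₀ + 1) + 2 * Nat.size (PP + 1)) := by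
    rw [pow_add, pow_add, two_mul, pow_add, pow_two]
    exact Nat.mul_lt_mul'' (Nat.mul_lt_mul'' h1 h2) (Nat.mul_lt_mul'' h3 h3)
  calc C0P k₀ n a b ≤ 345 * ((sP n a b + 1) * (k₀ + 1) * (PP + 1) ^ 2) := h
    _ < 512 * 2 ^ (Nat.size (sP n a b + 1) + Nat.size (k₀ + 1) + 2 * Nat.size (PP + 1)) := by
        have : 0 < (sP n a b + 1) * (k₀ + 1) * (PP + 1) ^ 2 := by positivity
        omega
    _ = 2 ^ (9 + Nat.size (sP n a b + 1) + Nat.size (k₀ + 1) + 2 * Nat.size (PP + 1)) := by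
        rw [show (512 : ℕ) = 2 ^ 9 by norm_num, ← pow_add]; exact congrArg (fun x => 2 ^ x) (by ring)

/-- `size G ≤ 6 + (P + size C₀)·D'`. [folklore] -/
theorem size_GP_le : Nat.size (GP d k₀ n a b) ≤ 6 + (PP + Nat.size (C0P k₀ n a b)) * DdP d := by
  rw [Nat.size_le, GP]
  have hC := Nat.lt_size_self (C0P k₀ n a b)
  have hD := one_le_DdP d
  have h1 : 2 ^ PP * C0P k₀ n a b < 2 ^ (PP + Nat.size (C0P k₀ n a b)) := by
    rw [pow_add]; exact Nat.mul_lt_mul_of_pos_left hC (Nat.two_pow_pos _)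
  have h2 : (2 ^ PP * C0P k₀ n a b) ^ DdP d < 2 ^ ((PP + Nat.size (C0P k₀ n a b)) * DdP d) := by
    rw [pow_mul]; exact Nat.pow_lt_pow_left h1 (by omega)
  calc 64 * (2 ^ PP * C0P k₀ n a b) ^ DdP d < 64 * 2 ^ ((PP + Nat.size (C0P k₀ n a b)) * DdP d) := by omega
    _ = 2 ^ (6 + (PP + Nat.size (C0P k₀ n a b)) * DdP d) := by rw [show (64 : ℕ) = 2 ^ 6 by norm_num, ← pow_add]

/-- The `s`-free part of the exponent of the good level. [folklore] -/
def c1P (d k₀ : ℕ) : ℕ := 6 + (PP + 9 + Nat.size (k₀ + 1) + 2 * Nat.size (PP + 1)) * DdP d + 8 * DdP d + 4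

/-- **`m ≤ 4D'(c₁ + D'·size(s+1))`.** [folklore] -/
theorem mP_le : mP d k₀ n a b ≤ 4 * DdP d * (c1P d k₀ + DdP d * Nat.size (sP n a b + 1)) := by
  have hG := size_GP_le d k₀ n a b
  have hC := size_C0P_le k₀ n a b
  rw [mP, jP]
  refine Nat.mul_le_mul_left _ ?_
  unfold c1P
  have : (PP + Nat.size (C0P k₀ n a b)) * DdP d ≤ (PP + 9 + Nat.size (k₀ + 1) + 2 * Nat.size (PP + 1)) * DdP d + DdP d * Nat.size (sP n a b + 1) := by
    calc (PP + Nat.size (C0P k₀ n a b)) * DdP d ≤ (PP + (9 + Nat.size (sP n a b + 1) + Nat.size (k₀ + 1) + 2 * Nat.size (PP + 1))) * DdP d :=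
          Nat.mul_le_mul_right _ (by omega)
      _ = (PP + 9 + Nat.size (k₀ + 1) + 2 * Nat.size (PP + 1)) * DdP d + DdP d * Nat.size (sP n a b + 1) := by ring
  omega

/-- **The good level is `≤ 2^{4D'c₁} (2(s+1))^{4D'²}`.** [folklore] -/
theorem goodLvlP_le : goodLvlP d k₀ n a b ≤ 2 ^ (4 * DdP d * c1P d k₀) * (2 * (sP n a b + 1)) ^ (4 * DdP d * DdP d) := by
  have h := mP_le d k₀ n a b
  have hs : 2 ^ Nat.size (sP n a b + 1) ≤ 2 * (sP n a b + 1) := by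
    have h1 : sP n a b + 1 < 2 ^ Nat.size (sP n a b + 1) := Nat.lt_size_self _
    have h2 : 2 ^ (Nat.size (sP n a b + 1) - 1) ≤ sP n a b + 1 := by
      have := Nat.lt_size.1 (show Nat.size (sP n a b + 1) - 1 < Nat.size (sP n a b + 1) by
        have : 0 < Nat.size (sP n a b + 1) := Nat.size_pos.2 (by omega); omega)
      exact this
    have hpos : 0 < Nat.size (sP n a b + 1) := Nat.size_pos.2 (by omega)
    calc 2 ^ Nat.size (sP n a b + 1) = 2 * 2 ^ (Nat.size (sP n a b + 1) - 1) := by rw [← pow_succ']; congr 1; omega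
      _ ≤ 2 * (sP n a b + 1) := Nat.mul_le_mul_left 2 h2
  rw [goodLvlP]
  calc 2 ^ mP d k₀ n a b ≤ 2 ^ (4 * DdP d * (c1P d k₀ + DdP d * Nat.size (sP n a b + 1))) := pow_mono h
    _ = 2 ^ (4 * DdP d * c1P d k₀) * (2 ^ Nat.size (sP n a b + 1)) ^ (4 * DdP d * DdP d) := by
        rw [← pow_mul, ← pow_add]; exact congrArg (fun x => 2 ^ x) (by ring)
    _ ≤ 2 ^ (4 * DdP d * c1P d k₀) * (2 * (sP n a b + 1)) ^ (4 * DdP d * DdP d) := Nat.mul_le_mul_left _ (Nat.pow_le_pow_left hs _)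

/-- The constant `K = 2^{11 + 4D'c₁ + 4D'²} (P+41)(P+1)`. [folklore] -/
def KP (d k₀ : ℕ) : ℕ := 2 ^ (11 + 4 * DdP d * c1P d k₀ + 4 * DdP d * DdP d) * ((PP + 41) * (PP + 1))

/-- The exponent `E = 4D'² + 1`. [folklore] -/
def EP (d : ℕ) : ℕ := 4 * DdP d * DdP d + 1

/-- **The coin length at the good level is `≤ 2^{K (s+1)^E}`.** [folklore] -/
theorem coinLenP_goodLvlP_le : coinLenP n a b (goodLvlP d k₀ n a b) ≤ 2 ^ (KP d k₀ * (sP n a b + 1) ^ EP d) := by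
  have h1 := coinLenP_le_pow n a b (goodLvlP d k₀ n a b)
  have h2 := bE_add_le n a b (goodLvlP d k₀ n a b)
  have h3 := goodLvlP_le d k₀ n a b
  refine h1.trans (pow_mono (h2.trans ?_))
  have hℓ1 : goodLvlP d k₀ n a b + 1 ≤ 2 * (2 ^ (4 * DdP d * c1P d k₀) * (2 * (sP n a b + 1)) ^ (4 * DdP d * DdP d)) := by
    have : 1 ≤ goodLvlP d k₀ n a b := Nat.one_le_two_pow
    omega
  rw [KP, EP]
  calc 2 ^ 10 * ((goodLvlP d k₀ n a b + 1) * (sP n a b + 1) * (PP + 41) * (PP + 1))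
      ≤ 2 ^ 10 * ((2 * (2 ^ (4 * DdP d * c1P d k₀) * (2 * (sP n a b + 1)) ^ (4 * DdP d * DdP d))) * (sP n a b + 1) * (PP + 41) * (PP + 1)) :=
        Nat.mul_le_mul_left _ (Nat.mul_le_mul_right _ (Nat.mul_le_mul_right _ (Nat.mul_le_mul_right _ hℓ1)))
    _ = 2 ^ (11 + 4 * DdP d * c1P d k₀ + 4 * DdP d * DdP d) * ((PP + 41) * (PP + 1)) * (sP n a b + 1) ^ (4 * DdP d * DdP d + 1) := by
        rw [mul_pow, pow_add 2 (11 + 4 * DdP d * c1P d k₀), pow_add 2 11, pow_succ (sP n a b + 1), show (2 : ℕ) ^ 11 = 2 ^ 10 * 2 by norm_num,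
          show (2 : ℕ) ^ (4 * DdP d * DdP d) = 2 ^ (4 * DdP d * DdP d) from rfl]
        ring

end Sizes

/-! ### Quasi-polynomial budgets -/

section Quasi

omit P in
/-- **A budget `≤ 2^{K(s+1)^E}` (for `a, b ≥ 1`, zero otherwise) is quasi-polynomial.** [folklore] -/
theorem isQuasiPolyBudget_of_le {t : ℕ → ℕ → ℕ → ℕ} (K E : ℕ) (h0 : ∀ n a b, a = 0 ∨ b = 0 → t n a b = 0)
    (h : ∀ n a b, 1 ≤ a → 1 ≤ b → t n a b ≤ 2 ^ (K * (sP n a b + 1) ^ E)) : IsQuasiPolyBudget t := by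
  refine ⟨Nat.size (K * 2 ^ E) + E, fun n a b => ?_⟩
  rcases Nat.eq_zero_or_pos a with ha | ha
  · rw [h0 n a b (Or.inl ha)]; exact Nat.zero_le _
  rcases Nat.eq_zero_or_pos b with hb | hb
  · rw [h0 n a b (Or.inr hb)]; exact Nat.zero_le _
  refine (h n a b ha hb).trans (pow_mono ?_)
  set L := Nat.log 2 (n + a + b + 2) with hL
  have hL2 : 2 ≤ L := by
    rw [hL]; exact Nat.le_log_of_pow_le (by norm_num) (by omega)
  have hs : sP n a b + 1 ≤ 2 * L := by
    have : sP n a b ≤ L + 1 := by rw [sP, Nat.size_le, hL]; exact Nat.lt_pow_succ_log_self (by norm_num) _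
    omega
  have hK : K * 2 ^ E < 2 ^ Nat.size (K * 2 ^ E) := Nat.lt_size_self _
  have hKL : 2 ^ Nat.size (K * 2 ^ E) ≤ L ^ Nat.size (K * 2 ^ E) := Nat.pow_le_pow_left hL2 _
  calc K * (sP n a b + 1) ^ E ≤ K * (2 * L) ^ E := Nat.mul_le_mul_left _ (Nat.pow_le_pow_left hs _)
    _ = K * 2 ^ E * L ^ E := by rw [mul_pow]; ring
    _ ≤ L ^ Nat.size (K * 2 ^ E) * L ^ E := Nat.mul_le_mul_right _ (hK.le.trans hKL)
    _ = L ^ (Nat.size (K * 2 ^ E) + E) := by rw [← pow_add]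

variable (d k₀ : ℕ)

/-- **The coin budget** of the `AC⁰[p]` learner. [folklore] -/
def cikkCoinsP (n a b : ℕ) : ℕ := if a = 0 ∨ b = 0 then 0 else coinLenP n a b (goodLvlP d k₀ n a b)

/-- **The round budget**: `qP(|⟨params, r⟩|) + 1` rounds with `|r| = coins`. [folklore] -/
def cikkRoundsP (n a b : ℕ) : ℕ := if a = 0 ∨ b = 0 then 0 else 2 * (2 * (pacParams n a b).length + 2 + cikkCoinsP d k₀ n a b) + 1

/-- The coin budget for `a, b ≥ 1`. [folklore] -/
theorem cikkCoinsP_eq {n a b : ℕ} (ha : 1 ≤ a) (hb : 1 ≤ b) : cikkCoinsP d k₀ n a b = coinLenP n a b (goodLvlP d k₀ n a b) := by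
  rw [cikkCoinsP, if_neg (by omega)]

/-- The round budget for `a, b ≥ 1`. [folklore] -/
theorem cikkRoundsP_eq {n a b : ℕ} (ha : 1 ≤ a) (hb : 1 ≤ b) :
    cikkRoundsP d k₀ n a b = 2 * (2 * (pacParams n a b).length + 2 + coinLenP n a b (goodLvlP d k₀ n a b)) + 1 := by
  rw [cikkRoundsP, if_neg (by omega), cikkCoinsP_eq d k₀ ha hb]

/-- **The coin budget is quasi-polynomial.** [cite: CarmosinoImpagliazzoKabanetsKolokolova2016, Cor. 5.4] -/
theorem isQuasiPolyBudget_cikkCoinsP : IsQuasiPolyBudget (cikkCoinsP d k₀) :=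
  isQuasiPolyBudget_of_le (KP d k₀) (EP d) (fun n a b h => by rw [cikkCoinsP, if_pos h]) fun n a b ha hb => by
    rw [cikkCoinsP_eq d k₀ ha hb]; exact coinLenP_goodLvlP_le d k₀ n a b

/-- **The round budget is quasi-polynomial.** [cite: CarmosinoImpagliazzoKabanetsKolokolova2016, Cor. 5.4] -/
theorem isQuasiPolyBudget_cikkRoundsP : IsQuasiPolyBudget (cikkRoundsP d k₀) := by
  refine isQuasiPolyBudget_of_le (2 ^ 6 * KP d k₀) (EP d) (fun n a b h => by rw [cikkRoundsP, if_pos h]) fun n a b ha hb => ?_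
  rw [cikkRoundsP_eq d k₀ ha hb, length_pacParams]
  have hc := coinLenP_goodLvlP_le d k₀ n a b
  have hn : n + a + b + 2 < 2 ^ sP n a b := Nat.lt_size_self _
  obtain ⟨F, hF⟩ : ∃ F, KP d k₀ * (sP n a b + 1) ^ EP d = F := ⟨_, rfl⟩
  rw [hF] at hc
  have hK1 : 1 ≤ KP d k₀ := by
    rw [KP]; exact one_le_mul_of_one_le_of_one_le Nat.one_le_two_pow (one_le_mul_of_one_le_of_one_le (by omega) (by omega))
  have hE1 : sP n a b + 1 ≤ (sP n a b + 1) ^ EP d := by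
    rw [EP, pow_succ]; exact Nat.le_mul_of_pos_left _ (Nat.pow_pos (by omega))
  have hsF : sP n a b + 1 ≤ F := by rw [← hF]; exact hE1.trans (Nat.le_mul_of_pos_left _ hK1)
  have h2s : 2 ^ sP n a b ≤ 2 ^ F := pow_mono (by omega)
  have hlin : 2 * (2 * n + 2 * a + b + 4) + 2 ≤ 6 * 2 ^ sP n a b := by omega
  have hstep : 2 * (2 * (2 * n + 2 * a + b + 4) + 2 + coinLenP n a b (goodLvlP d k₀ n a b)) + 1 ≤ 2 ^ (F + 5) := by
    rw [pow_add]; omega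
  refine hstep.trans (pow_mono ?_)
  rw [Nat.mul_assoc, hF]; omega

omit P in
/-- The constant budget `1` is quasi-polynomial. [folklore] -/
theorem isQuasiPolyBudget_one : IsQuasiPolyBudget fun _ _ _ => 1 :=
  ⟨0, fun n a b => by rw [pow_zero, pow_one]; norm_num⟩

end Quasi

end Modp

end Literature.Computability.Learning


/-!
## Part — CIKK 2016, Corollary 5.4: `AC⁰[p]` is learnable in quasi-polynomial time (discharge)

The discharge `cikk_learn_AC0Mod_holds` of the named fact
`Literature.Computability.Learning.cikk_learn_AC0Mod`: for every prime `p`, depth `d` and size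
exponent `k₀`, the learner `cikkLearnerP (propFn (rsProperty p))` with the evaluator
`cikkEvalP (propFn (rsProperty p))`, the coin budget `cikkCoinsP d k₀`, the round budget
`cikkRoundsP d k₀` and one evaluation round is a PAC predictor for `ac0ModClass p d k₀` under the
uniform distribution with membership queries (`isPACPredictorFor_cikkP`), its step functions are
polynomial-time (`LearnerP`) and its budgets quasi-polynomial (`BudgetP`).

The argument is the one of CIKK Thm. 5.1 with the Razborov–Smolensky natural property
(`SmolenskyNaturalProperty`, useful against `AC⁰[p]` by `AmpPCircuit`, constructive by
`SmolenskyConstructive`) and the `AC⁰[p]`-computable black-box amplification `AMP_p`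
(`AmpPFunction`, Thm. 4.8): `AnalysisP` (counting), `LevelP`/`GoodLvlP` (the good level),
`ParamsIneqP` (the inequalities).

## References

* M. Carmosino, R. Impagliazzo, V. Kabanets, A. Kolokolova, *Learning algorithms from natural
  proofs*, CCC 2016, Thm. 5.1, Cor. 5.4 [CarmosinoImpagliazzoKabanetsKolokolova2016].
* A. A. Razborov, *Lower bounds on the size of bounded depth circuits over a complete basis with
  logical addition*, 1987 [Razborov1987].
* R. Smolensky, *Algebraic methods in the theory of lower bounds for Boolean circuit complexity*, STOC 1987 [Smolensky1987].
-/

namespace Literature.Computability.Learning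

namespace Modp

open Literature.Computability.Complexity Literature.Computability.MetaComplexity Literature.Computability.MetaComplexity.Smolensky
  Literature.Computability.Cryptography _root_.Computability Finset Polynomial

variable [P : PrimeP]

-- the nested coin products exceed the default instance size bound
set_option synthInstance.maxSize 2048
set_option synthInstance.maxHeartbeats 400000

/-- `1 ≤ coinLenP`. [folklore] -/
theorem one_le_coinLenP (n a b ℓg : ℕ) : 1 ≤ coinLenP n a b ℓg := by
  rw [coinLenP]; have := lvlCoffP_lt_succ (n := n) (a := a) (b := b) ℓg; omega

/-- **A successful coin string yields an `ε`-good hypothesis.** [cite: CarmosinoImpagliazzoKabanetsKolokolova2016, Thm. 5.1 (proof)] -/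
theorem errorProb_le_of_successP {dR : List Bool → List Bool} {n a b : ℕ} {f : (Fin n → Bool) → Bool} {ℓg : ℕ}
    {ε : ℝ} (hε : 0 < ε) (ha : a = invCeil ε) (rv : Fin (coinLenP n a b ℓg) → Bool) (hS : SuccessP dR n a b f ℓg rv) :
    errorProb (PMF.uniformOfFintype (Fin n → Bool))
      (evalHyp (cikkEvalP dR) 1 (gOutN dR n a b (coinsListP n a b ℓg rv) (ansOfP n a b f ℓg rv))) f ≤ ENNReal.ofReal ε := by
  obtain ⟨ℓ, ρ, hout, herr⟩ := hS
  rw [hout, evalHyp_cikkEvalP_candN, errorProb_uniform_eq, Fintype.card_fun, Fintype.card_fin, Fintype.card_bool]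
  have ha1 : 1 ≤ a := ha ▸ one_le_invCeil hε
  have haε : 1 / (a : ℝ) ≤ ε := ha ▸ one_div_invCeil_le hε
  set h₀ := hypOfP dR n a b (coinsListP n a b ℓg rv) (ansOfP n a b f ℓg rv) ℓ ρ with hh₀
  have hR : ((errCount n f h₀ : ℕ) : ℝ) / 2 ^ n ≤ ε := by
    have h' : ((a * errCount n f h₀ : ℕ) : ℝ) ≤ ((2 ^ n : ℕ) : ℝ) := by exact_mod_cast herr
    push_cast at h'
    have ha' : (0 : ℝ) < a := by exact_mod_cast ha1
    rw [div_le_iff₀ (by positivity)]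
    calc (errCount n f h₀ : ℝ) ≤ 2 ^ n / a := by rw [le_div_iff₀ ha']; linarith
      _ = 1 / a * 2 ^ n := by ring
      _ ≤ ε * 2 ^ n := mul_le_mul_of_nonneg_right haε (by positivity)
  rw [errCount] at hR
  calc (((univ.filter fun x => h₀ x ≠ f x).card : ℕ) : ENNReal) / ((2 ^ n : ℕ) : ENNReal)
      = ENNReal.ofReal ((((univ.filter fun x => h₀ x ≠ f x).card : ℕ) : ℝ) / 2 ^ n) := by
        rw [ENNReal.ofReal_div_of_pos (by positivity), ENNReal.ofReal_natCast, ENNReal.ofReal_pow (by norm_num), ENNReal.ofReal_ofNat]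
        push_cast; rfl
    _ ≤ ENNReal.ofReal ε := ENNReal.ofReal_le_ofReal hR

/-- `p₀' = p₀ · (validity factor) ≤ 1`. [folklore] -/
theorem pZeroP'_le_one (n a b ℓ : ℕ) :
    pZeroP n a b ℓ * (1 - (𝔭 : ℝ) * nBlocks (κP n a b ℓ) (τP ℓ) (kkP n a b ℓ) (tP n a b ℓ) / (2 : ℝ) ^ βP n a b ℓ) ≤ 1 := by
  have h1 := pZeroP_le_one n a b ℓ
  have h0 : (0 : ℝ) ≤ pZeroP n a b ℓ := le_trans (pow_nonneg (by norm_num : (0 : ℝ) ≤ 1 / 2) _) (half_pow_le_pZeroP n a b ℓ)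
  have hx : (0 : ℝ) ≤ (𝔭 : ℝ) * nBlocks (κP n a b ℓ) (τP ℓ) (kkP n a b ℓ) (tP n a b ℓ) / (2 : ℝ) ^ βP n a b ℓ :=
    div_nonneg (mul_nonneg (Nat.cast_nonneg _) (Nat.cast_nonneg _)) (pow_nonneg two_pos.le _)
  generalize (𝔭 : ℝ) * nBlocks (κP n a b ℓ) (τP ℓ) (kkP n a b ℓ) (tP n a b ℓ) / (2 : ℝ) ^ βP n a b ℓ = x at hx ⊢
  generalize pZeroP n a b ℓ = q at h1 h0 ⊢
  nlinarith

omit P in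
/-- `1/(2b) = 1/(4b) + 1/(4b)`. [folklore] -/
theorem half_b_split {b : ℕ} (hb : 1 ≤ b) : (1 : ℝ) / (2 * b) = 1 / (4 * b) + 1 / (4 * b) := by
  have hb' : (0 : ℝ) < b := by exact_mod_cast hb
  field_simp; ring

open scoped Classical in
/-- **The failure count of the learner at the good level is `≤ 2^{coinLen}/(2b)`** for targets in
`AC⁰[p]` of depth `d` and size `n^{k₀} + k₀` (`a, b ≥ 1`). [cite: CarmosinoImpagliazzoKabanetsKolokolova2016, Thm. 5.1 (proof), Cor. 5.4] -/
theorem card_not_successP_le_half (d k₀ : ℕ) {n a b : ℕ} (ha : 1 ≤ a) (hb : 1 ≤ b) {f : (Fin n → Bool) → Bool} (hf : f ∈ ac0ModClass 𝔭 d k₀ n) :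
    ((univ.filter fun rv => ¬ SuccessP (propFn (rsProperty 𝔭)) n a b f (goodLvlP d k₀ n a b) rv).card : ℝ) ≤
      1 / (2 * b) * 2 ^ coinLenP n a b (goodLvlP d k₀ n a b) := by
  have hgood := goodLvlP_good d k₀ n a b
  generalize goodLvlP d k₀ n a b = ℓg at hgood ⊢
  have hadv := hadv_of_goodLevelP hgood hf
  have hdRFP : propFn (rsProperty 𝔭) ∈ FP := propFn_mem_FP isConstructive_rsProperty
  have hGT := card_typedGood_ge (rsProperty 𝔭) f ha (lvlHyps_holds n a b ℓg ha) hadv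
  have hp0 : (0 : ℝ) ≤ pZeroP n a b ℓg := le_trans (pow_nonneg (by norm_num : (0 : ℝ) ≤ 1 / 2) _) (half_pow_le_pZeroP n a b ℓg)
  have hp := card_goodWP_ge (rsProperty 𝔭) hdRFP (fun y => rfl) f ℓg hp0 hGT
  have h := card_not_successP_le (dR := propFn (rsProperty 𝔭)) (f := f) ha hp
  have h1 := rep_boundP n a b ℓg hb (half_pow_le_pZeroP' n a b ℓg) (pZeroP'_le_one n a b ℓg)
  have h2 := val_boundP n a b ha hb ℓg
  refine h.trans ?_
  rw [half_b_split hb]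
  exact mul_le_mul_of_nonneg_right (add_le_add h1 h2) (pow_nonneg two_pos.le _)

set_option linter.constructorNameAsVariable false in
/-- **CIKK Theorem 5.1 for the `AC⁰[p]` learner**: the PAC guarantee.
[cite: CarmosinoImpagliazzoKabanetsKolokolova2016, Thm. 5.1, Cor. 5.4] -/
theorem isPACPredictorFor_cikkP (d k₀ : ℕ) :
    IsPACPredictorFor uniformDistributions true (ac0ModClass 𝔭 d k₀) (cikkLearnerP (propFn (rsProperty 𝔭))) (cikkEvalP (propFn (rsProperty 𝔭)))
      (cikkCoinsP d k₀) (cikkRoundsP d k₀) fun _ _ _ => 1 := by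
  classical
  intro n f hf D hDm ε δ hε _hε1 hδ _hδ1
  rw [uniformDistributions, Set.mem_singleton_iff] at hDm
  subst hDm
  have hdRFP : propFn (rsProperty 𝔭) ∈ FP := propFn_mem_FP isConstructive_rsProperty
  set a := invCeil ε with ha
  set b := invCeil δ with hb
  have ha1 : 1 ≤ a := one_le_invCeil hε
  have hb1 : 1 ≤ b := one_le_invCeil hδ
  set ℓg := goodLvlP d k₀ n a b with hℓg
  set C := coinLenP n a b ℓg with hC
  have hCdef : cikkCoinsP d k₀ n a b = C := cikkCoinsP_eq d k₀ ha1 hb1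
  have hTdef : cikkRoundsP d k₀ n a b = 2 * (2 * (pacParams n a b).length + 2 + C) + 1 := cikkRoundsP_eq d k₀ ha1 hb1
  -- the PAC game as a count over coin strings
  set good : List.Vector Bool C → Bool := fun r =>
    decide (errorProb (PMF.uniformOfFintype (Fin n → Bool)) (evalHyp (cikkEvalP (propFn (rsProperty 𝔭))) 1
      (gOutN (propFn (rsProperty 𝔭)) n a b r.toList (ansListP n a b r.toList f (qP.eval (boolPair (pacParams n a b) r.toList).length)))) f ≤
      ENNReal.ofReal ε) with hgood
  rw [hCdef, hTdef, pacSuccessProb_eq_card _ true (cikkLearnerP (propFn (rsProperty 𝔭))) (pacParams n a b) _ C f _ ε good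
    (fun xs r => by
      rw [runIdx_cikkLearnerP (dR := propFn (rsProperty 𝔭)) a b r.toList f xs
        (by rw [qP, eval_mul, eval_ofNat, eval_X, length_boolPair, List.Vector.toList_length]; omega), gPFn_apply hdRFP])]
  -- success implies a good hypothesis
  have hsub : (univ.filter fun rv : Fin C → Bool => SuccessP (propFn (rsProperty 𝔭)) n a b f ℓg rv).card ≤
      (univ.filter fun r : List.Vector Bool C => good r = true).card := by
    rw [← card_filter_univ_equiv (Equiv.vectorEquivFin Bool C) (fun rv : Fin C → Bool => SuccessP (propFn (rsProperty 𝔭)) n a b f ℓg rv)]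
    refine Finset.card_le_card fun r hr => ?_
    simp only [Finset.mem_filter, Finset.mem_univ, true_and] at hr ⊢
    rw [hgood, decide_eq_true_eq]
    have hl : r.toList = List.ofFn ((Equiv.vectorEquivFin Bool C) r) := by
      rw [show r.toList = (List.Vector.ofFn ((Equiv.vectorEquivFin Bool C) r)).toList by
        rw [Equiv.vectorEquivFin, Equiv.coe_fn_mk, List.Vector.ofFn_get], List.Vector.toList_ofFn]
    rw [hl]
    exact errorProb_le_of_successP hε ha _ (by simpa using hr)
  -- counting
  have hfail : ((univ.filter fun rv : Fin C → Bool => ¬ SuccessP (propFn (rsProperty 𝔭)) n a b f ℓg rv).card : ℝ) ≤ 1 / (2 * b) * 2 ^ C :=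
    card_not_successP_le_half d k₀ ha1 hb1 hf
  have htot : ((univ.filter fun rv : Fin C → Bool => SuccessP (propFn (rsProperty 𝔭)) n a b f ℓg rv).card : ℝ) +
      ((univ.filter fun rv : Fin C → Bool => ¬ SuccessP (propFn (rsProperty 𝔭)) n a b f ℓg rv).card : ℝ) = 2 ^ C := by
    have := Finset.card_filter_add_card_filter_not (s := (univ : Finset (Fin C → Bool))) (fun rv => SuccessP (propFn (rsProperty 𝔭)) n a b f ℓg rv)
    rw [Finset.card_univ, Fintype.card_fun, Fintype.card_fin, Fintype.card_bool] at this
    exact_mod_cast this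
  have hb' : (0 : ℝ) < b := by exact_mod_cast hb1
  have hbδ : 1 / (2 * (b : ℝ)) ≤ δ := by
    have := one_div_invCeil_le hδ
    rw [← hb] at this
    calc 1 / (2 * (b : ℝ)) = (1 / b) / 2 := by field_simp
      _ ≤ δ / 2 := by gcongr
      _ ≤ δ := by linarith
  have hreal : 1 - δ ≤ ((univ.filter fun r : List.Vector Bool C => good r = true).card : ℝ) / 2 ^ C := by
    rw [le_div_iff₀ (by positivity)]
    have hsubR : ((univ.filter fun rv : Fin C → Bool => SuccessP (propFn (rsProperty 𝔭)) n a b f ℓg rv).card : ℝ) ≤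
        ((univ.filter fun r : List.Vector Bool C => good r = true).card : ℝ) := by exact_mod_cast hsub
    have h2C : (0 : ℝ) < 2 ^ C := by positivity
    have hδC := mul_le_mul_of_nonneg_right hbδ h2C.le
    linarith [hfail, htot, hsubR, hδC]
  -- to `ℝ≥0∞`
  have h2 : (2 : ENNReal) ^ C = ENNReal.ofReal ((2 : ℝ) ^ C) := by rw [ENNReal.ofReal_pow (by norm_num), ENNReal.ofReal_ofNat]
  rw [h2, ← ENNReal.ofReal_natCast, ← ENNReal.ofReal_div_of_pos (by positivity)]
  exact ENNReal.ofReal_le_ofReal hreal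

end Modp

open Literature.Computability.MetaComplexity.Smolensky Modp in
/-- **CIKK 2016, Corollary 5.4** (discharge of the named fact `cikk_learn_AC0Mod`): for every prime
`p`, depth `d` and size exponent `k`, the class `AC⁰[p]` of depth `d` and size `n^k + k` is learnable
with membership queries under the uniform distribution by a randomized predictor with
polynomial-time steps and quasi-polynomial coin and round budgets.
[cite: CarmosinoImpagliazzoKabanetsKolokolova2016, Cor. 5.4] -/
theorem cikk_learn_AC0Mod_holds : cikk_learn_AC0Mod := by
  intro p hp d k₀
  letI P : PrimeP := ⟨p, hp⟩
  have hdRFP := propFn_mem_FP (isConstructive_rsProperty (p := 𝔭))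
  exact ⟨cikkLearnerP (propFn (rsProperty 𝔭)), cikkEvalP (propFn (rsProperty 𝔭)), cikkCoinsP d k₀, cikkRoundsP d k₀, fun _ _ _ => 1,
    isPolyTime_cikkLearnerP hdRFP, isPolyTime_cikkEvalP hdRFP, isQuasiPolyBudget_cikkCoinsP d k₀, isQuasiPolyBudget_cikkRoundsP d k₀,
    isQuasiPolyBudget_one, isPACPredictorFor_cikkP d k₀⟩

end Literature.Computability.Learning
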